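import Literature.Analysis.FluidPDE.SlicedLocalEnergy
import Literature.Analysis.FluidPDE.SchefferTestFunction
import Literature.Analysis.FluidPDE.CKNScalingExtras
import Literature.Analysis.FluidPDE.CKNInterpolationEstimate
import Literature.Analysis.FunctionSpaces.WeakNormSq
import Literature.Analysis.FunctionSpaces.SobolevPoincareBall
import HarnessLib

/-!
# The local-energy decay estimate (Robinson–Rodrigo–Sadowski 2016, (16.13), with a force)

Analysis/FluidPDE file in the decomposition of the named fact
`Literature.Analysis.FluidPDE.ckn_epsilon_regularity` (`PartialRegularity.lean`, ns.S12:
Caffarelli–Kohn–Nirenberg 1982, Proposition 2). It **proves** the decomposition target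
`Literature.Analysis.FluidPDE.localEnergyEstimate` (`CKNEpsilonRegularityAssembly.lean`): absolute constants
`κ₁, …, κ₄` with
`A(θr) + E(θr) ≤ κ₁θ²(A(r) + E(r)) + κ₂θ⁻⁶A(r)E(r) + κ₃θ⁻⁶D(r)^{4/3} + κ₄θ⁻⁴F_q(r)^{2/q}`
for every suitable weak solution (`ν = 1`) with force `f ∈ L^q`, `q > 5/2`, every weak spatial
gradient, every cylinder with `closure Q_r(z) ⊆ Q` and every `θ ∈ (0, 1/2]`
(Robinson–Rodrigo–Sadowski 2016, proof of Thm. 16.1, (16.6)–(16.13), pp. 241–242, with the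
force term of Caffarelli–Kohn–Nirenberg 1982, §§3, 6 added).

## Proof

By `localEnergyEstimate_of_unitScale` (`CKNScalingExtras.lean`) it suffices to treat `r = 1`,
`z = 0`, `Q₁ = (-1, 0) × B₁`. Let `ψ` be Scheffer's localised backward heat kernel on the unit
cylinder with inner radius `θ` (the tree's `Scheffer.testFn 1 θ 1 0 0`, `SchefferTestFunction.lean`,
Lemarié-Rieusset 2016, §13.9; Robinson–Rodrigo–Sadowski 2016, Lemma 16.6) and `φ = ψ/θ`:
`0 ≤ φ ≤ C/θ`, `φ ≥ (Cθ)⁻¹` on `Q_θ`, `|∇φ| ≤ C/θ²`, `|φₜ + Δφ| ≤ Cθ²` for `t < θ²`, `φ(t, ·)`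
supported in `B_{5/8}` and `φ = 0` for `t ≤ -1/2`. Since `φ` does not vanish for `t > 0`, the
local energy inequality is applied, in its sliced form for a.e. `s < 0`
(`IsSuitableWeakSolutionOn.ae_localEnergy_slice`, `SlicedLocalEnergy.lean`), to the test functions
`ηₖ(t) φ(t, x)` on `Q₁` with smooth time cut-offs `ηₖ = 1` on `(-∞, -2εₖ]`, `= 0` on
`[-εₖ/2, ∞)`; for `s ≤ -2εₖ` all terms agree with those of `φ` (`ae_localEnergy_slice_cutoff`).
The left-hand side controls `θ⁻¹ ∫_{B_θ} |u(s)|²` for a.e. `s ∈ (-θ², 0)` — hence `A(θ)`, an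
essential supremum — and, letting `s ↑ 0` along good times, `θ⁻¹ ∫∫_{Q_θ} |∇u|²`. On the right,
the mean `(|u|²)_{B₁}(t)` is subtracted from `|u|²` in the cubic term (`u(t)` is weakly
divergence free and `φ(t, ·) ∈ C_c^∞(B₁)`), and the four terms are bounded as on pp. 241–242:
`∫∫ |u|²|φₜ + Δφ| ≤ Cθ² |Q₁|^{1/3} C(1)^{2/3}`;
`∫∫ ||u|² - (|u|²)₁| |u| |∇φ| ≤ Cθ⁻² ∫ ‖|u|² - (|u|²)₁‖_{L^{3/2}(B₁)} ‖u‖_{L³(B₁)} dt ≤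
2 C C_SP θ⁻² A^{1/2} E^{1/2} C(1)^{1/3}` (Sobolev–Poincaré for the `W^{1,1}` function `|u(t)|²`,
`SobolevPoincareBall.lean` and `WeakNormSq.lean`, Hölder in `t`);
`2∫∫ |p||u||∇φ| ≤ 2Cθ⁻² D^{2/3} C(1)^{1/3}`; `2∫∫ |f||u| φ ≤ 2Cθ⁻¹ c_q F_q^{1/q} C(1)^{1/3}`
(`c_q = |Q₁|^{1 - 1/q - 1/3} ≤ |Q₁|`). Young's inequality puts the last three in the form
`½θ² C(1)^{2/3} + (const) θ⁻⁶ AE`, `… θ⁻⁶ D^{4/3}`, `… θ⁻⁴ F_q^{2/q}`, and the interpolation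
inequality (`interpolationEstimate_holds`, `CKNInterpolationEstimate.lean`) gives
`C(1)^{2/3} ≤ C₀^{2/3}(A + E)`.

## References

* J. C. Robinson, J. L. Rodrigo, W. Sadowski, *The three-dimensional Navier–Stokes equations*,
  Cambridge Studies in Advanced Mathematics 157 (2016), proof of Thm. 16.1, (16.6)–(16.13),
  Lemma 16.6, pp. 238–243, 251.
* L. Caffarelli, R. Kohn, L. Nirenberg, *Partial regularity of suitable weak solutions of the
  Navier–Stokes equations*, Comm. Pure Appl. Math. 35 (1982), §2 (2.5), §3, Lemma 5.1, §6.
* P. G. Lemarié-Rieusset, *The Navier–Stokes Problem in the 21st Century* (2016), §13.9 Step 1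
  (Scheffer's test function).
-/

noncomputable section

open MeasureTheory Set Function Filter Topology TopologicalSpace Metric Module
open scoped NNReal ENNReal InnerProductSpace RealInnerProductSpace Laplacian

namespace Literature.Analysis.FluidPDE

/-! ### Localising the sliced local energy inequality with time cut-offs -/

section Cutoff

variable {E : Type*} [NormedAddCommGroup E] [InnerProductSpace ℝ E] [FiniteDimensional ℝ E]
  [MeasurableSpace E] [BorelSpace E]

omit [MeasurableSpace E] [BorelSpace E] in
/-- **Time-cut weights are test functions on `Q₁(0)`.** If `φ` is smooth on `ℝ × E` with
`φ(t, y) ≠ 0 ⟹ -1/2 < t ∧ ‖y‖ < 5/8`, and `η` is smooth with `η(t) = 0` for `t ≥ -ε/2`,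
`ε > 0`, then `η(t) φ(t, y)` is a space–time test function on `Q₁(0) = (-1, 0) × B₁`
(its support lies in `[-1/2, -ε/2] × B̄_{5/8}`). [folklore] -/
theorem isSpaceTimeTestOn_timeCut_mul {φ : ℝ → E → ℝ} (hφ : ContDiff ℝ (⊤ : ℕ∞) (uncurry φ))
    (hφt : ∀ s y, φ s y ≠ 0 → -(1 / 2 : ℝ) < s) (hφx : ∀ s y, φ s y ≠ 0 → ‖y‖ < 5 / 8)
    {η : ℝ → ℝ} (hη : ContDiff ℝ (⊤ : ℕ∞) η) {ε : ℝ} (hε : 0 < ε)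
    (hη0 : ∀ t, -(ε / 2) ≤ t → η t = 0) :
    IsSpaceTimeTestOn (parabolicCylinderOpens 1 (0 : ℝ × E)) (fun t y => η t * φ t y) := by
  have hQ1 : parabolicCylinder 1 (0 : ℝ × E) = Ioo (-1 : ℝ) 0 ×ˢ ball (0 : E) 1 := by
    simp [parabolicCylinder]
  set K : Set (ℝ × E) := Icc (-(1 / 2 : ℝ)) (-ε / 2) ×ˢ closedBall (0 : E) (5 / 8) with hK
  have hKc : IsCompact K := isCompact_Icc.prod (isCompact_closedBall _ _)
  have hsupp : ∀ z : ℝ × E, uncurry (fun t y => η t * φ t y) z ≠ 0 → z ∈ K := by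
    rintro ⟨s, y⟩ hz
    simp only [uncurry] at hz
    have h1 : η s ≠ 0 := left_ne_zero_of_mul hz
    have h2 : φ s y ≠ 0 := right_ne_zero_of_mul hz
    have h3 : s < -ε / 2 := by
      by_contra h'
      exact h1 (hη0 s (by linarith [not_lt.1 h']))
    refine ⟨⟨(hφt s y h2).le, h3.le⟩, ?_⟩
    rw [mem_closedBall, dist_zero_right]
    exact (hφx s y h2).le
  have hKQ : K ⊆ parabolicCylinder 1 (0 : ℝ × E) := by
    rw [hQ1]
    rintro ⟨s, y⟩ ⟨⟨hs1, hs2⟩, hy⟩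
    refine ⟨⟨by linarith, by linarith⟩, ?_⟩
    rw [mem_closedBall, dist_zero_right] at hy
    rw [mem_ball, dist_zero_right]
    linarith
  refine ⟨?_, HasCompactSupport.intro hKc fun z hz => by_contra fun h' => hz (hsupp z h'), ?_⟩
  · have e : uncurry (fun t y => η t * φ t y) = fun z : ℝ × E => η z.1 * uncurry φ z := by
      funext z; rfl
    rw [e]
    exact (hη.comp contDiff_fst).mul hφ
  · exact (closure_minimal (fun z hz => hsupp z (Function.mem_support.1 hz)) hKc.isClosed).trans hKQ

/-- **Slices of weakly divergence-free fields against time-dependent weights.** For a field `u`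
locally integrable and weakly divergence free on `Q₁(0)` and a smooth weight `φ` as above (no
condition for `t ≥ 0`), `∫ ⟪u(t, x), ∇φ(t, ·)(x)⟫ dx = 0` for a.e. `t < 0` (apply the accepted
`ae_integral_inner_gradient_eq_zero` to the test functions `ηₖ φ`). [folklore] -/
theorem ae_integral_inner_gradient_timeCut_eq_zero {u : ℝ → E → E}
    (hu : LocallyIntegrableOn (uncurry u) (parabolicCylinder 1 (0 : ℝ × E)) volume)
    (hdiv : ∀ θ : ℝ → E → ℝ, IsSpaceTimeTestOn (parabolicCylinderOpens 1 (0 : ℝ × E)) θ →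
      ∫ z in parabolicCylinder 1 (0 : ℝ × E), ⟪u z.1 z.2, gradient (θ z.1) z.2⟫ = 0)
    {φ : ℝ → E → ℝ} (hφ : ContDiff ℝ (⊤ : ℕ∞) (uncurry φ))
    (hφt : ∀ s y, φ s y ≠ 0 → -(1 / 2 : ℝ) < s) (hφx : ∀ s y, φ s y ≠ 0 → ‖y‖ < 5 / 8) :
    ∀ᵐ t ∂(volume : Measure ℝ), t < 0 → ∫ x, ⟪u t x, gradient (φ t) x⟫ = 0 := by
  obtain ⟨C, -, hcut⟩ := exists_time_cutoff
  set ε : ℕ → ℝ := fun n => 1 / ((n : ℝ) + 1) with hε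
  have hεpos : ∀ n, 0 < ε n := fun n => Nat.one_div_pos_of_nat
  choose η k hηs hη01 hη1 hη0 hηd hkc hkb hks hk1 using fun n => hcut 0 (ε n) (hεpos n)
  simp only [zero_sub] at hη1 hη0
  have hΦ : ∀ n, IsSpaceTimeTestOn (parabolicCylinderOpens 1 (0 : ℝ × E)) (fun t y => η n t * φ t y) :=
    fun n => isSpaceTimeTestOn_timeCut_mul hφ hφt hφx (hηs n) (hεpos n) (fun t ht => hη0 n t (by linarith))
  have hae : ∀ᵐ t ∂(volume : Measure ℝ), ∀ n,
      ∫ x, ⟪u t x, gradient (fun y => η n t * φ t y) x⟫ = 0 :=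
    ae_all_iff.2 fun n => ae_integral_inner_gradient_eq_zero
      (Q := parabolicCylinderOpens 1 (0 : ℝ × E)) hu hdiv (hΦ n)
  filter_upwards [hae] with t ht ht0
  obtain ⟨n, hn⟩ := exists_nat_one_div_lt (by linarith : 0 < -t / 2)
  have hn' : t ≤ -(2 * ε n) := by
    have : ε n < -t / 2 := hn
    linarith
  have h1 : η n t = 1 := hη1 n t hn'
  have := ht n
  simp only [h1, one_mul] at this
  exact this

/-- **The sliced local energy inequality on `Q₁(0)` for smooth weights vanishing only towards
the past.** Let `(u, p)` be a suitable weak solution on `Q₁ = (-1, 0) × B₁` with `|u|³` and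
`f·u` locally integrable, `G` a weak spatial gradient, and `φ ≥ 0` a smooth function on `ℝ × E`
with `φ(t, y) ≠ 0 ⟹ -1/2 < t` and `‖y‖ < 5/8` (no condition for `t ≥ 0`). Then for a.e. `s < 0`,
`∫ |u(s)|² φ(s) + 2ν ∫∫_{t<s} |G|² φ ≤ ∫∫_{t<s} (|u|²(φₜ + νΔφ) + (|u|² + 2p) u·∇φ + 2 f·u φ)`:
apply `IsSuitableWeakSolutionOn.ae_localEnergy_slice` to the test functions `ηₖ(t) φ(t, y)` on
`Q₁`, `ηₖ` smooth time cut-offs equal to `1` on `(-∞, -2εₖ]` and to `0` on `[-εₖ/2, ∞)`,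
`εₖ → 0`; for `s ≤ -2εₖ` every term equals the corresponding term for `φ` (Robinson–Rodrigo–
Sadowski 2016, p. 241, where the cut-off of Lemma 16.6 is used in (15.8) "for every `t`").
[cite: RobinsonRodrigoSadowski2016, proof of Thm. 16.1 p. 241] -/
theorem ae_localEnergy_slice_cutoff {ν : ℝ} {f u : ℝ → E → E} {p : ℝ → E → ℝ}
    {G : ℝ → E → E →L[ℝ] E}
    (h : IsSuitableWeakSolutionOn (parabolicCylinderOpens 1 (0 : ℝ × E)) ν f u p)
    (hG : HasWeakSpatialGradientOn (parabolicCylinderOpens 1 (0 : ℝ × E)) u G)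
    (hu3 : LocallyIntegrableOn (fun z : ℝ × E => ‖u z.1 z.2‖ ^ 3) (parabolicCylinder 1 (0 : ℝ × E))
      volume)
    (hfu : LocallyIntegrableOn (fun z : ℝ × E => ⟪f z.1 z.2, u z.1 z.2⟫)
      (parabolicCylinder 1 (0 : ℝ × E)) volume)
    {φ : ℝ → E → ℝ} (hφ : ContDiff ℝ (⊤ : ℕ∞) (uncurry φ)) (hφ0 : ∀ s y, 0 ≤ φ s y)
    (hφt : ∀ s y, φ s y ≠ 0 → -(1 / 2 : ℝ) < s) (hφx : ∀ s y, φ s y ≠ 0 → ‖y‖ < 5 / 8) :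
    ∀ᵐ s ∂(volume : Measure ℝ), s < 0 →
      (∫ x, ‖u s x‖ ^ 2 * φ s x) +
          2 * ν * ∫ z in {z : ℝ × E | z.1 < s}, frobeniusNormSq (G z.1 z.2) * φ z.1 z.2 ≤
        ∫ z in {z : ℝ × E | z.1 < s}, (‖u z.1 z.2‖ ^ 2 * (timeDeriv φ z.1 z.2 + ν * Δ (φ z.1) z.2) +
          (‖u z.1 z.2‖ ^ 2 + 2 * p z.1 z.2) * ⟪u z.1 z.2, gradient (φ z.1) z.2⟫ +
          2 * ⟪f z.1 z.2, u z.1 z.2⟫ * φ z.1 z.2) := by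
  -- the time cut-offs at `s = 0`
  obtain ⟨C, -, hcut⟩ := exists_time_cutoff
  set ε : ℕ → ℝ := fun n => 1 / ((n : ℝ) + 1) with hε
  have hεpos : ∀ n, 0 < ε n := fun n => Nat.one_div_pos_of_nat
  choose η k hηs hη01 hη1 hη0 hηd hkc hkb hks hk1 using fun n => hcut 0 (ε n) (hεpos n)
  simp only [zero_sub] at hη1 hη0 hks
  -- the test functions `ηₙ φ` on `Q₁`
  set Φ : ℕ → ℝ → E → ℝ := fun n s y => η n s * φ s y with hΦ
  have hQ1 : parabolicCylinder 1 (0 : ℝ × E) = Ioo (-1 : ℝ) 0 ×ˢ ball (0 : E) 1 := by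
    simp [parabolicCylinder]
  have hΦtest : ∀ n, IsSpaceTimeTestOn (parabolicCylinderOpens 1 (0 : ℝ × E)) (Φ n) := fun n =>
    isSpaceTimeTestOn_timeCut_mul hφ hφt hφx (hηs n) (hεpos n) (fun t ht => hη0 n t (by linarith))
  have hΦ0 : ∀ n s y, 0 ≤ Φ n s y := fun n s y => mul_nonneg (hη01 n s).1 (hφ0 s y)
  -- the sliced inequality for every `Φ n`, at a.e. `s`
  have hLEI : ∀ᵐ s ∂(volume : Measure ℝ), ∀ n,
      (∫ x, ‖u s x‖ ^ 2 * Φ n s x) +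
          2 * ν * ∫ z in {z : ℝ × E | z.1 < s}, frobeniusNormSq (G z.1 z.2) * Φ n z.1 z.2 ≤
        ∫ z in {z : ℝ × E | z.1 < s}, (‖u z.1 z.2‖ ^ 2 *
            (timeDeriv (Φ n) z.1 z.2 + ν * Δ (Φ n z.1) z.2) +
          (‖u z.1 z.2‖ ^ 2 + 2 * p z.1 z.2) * ⟪u z.1 z.2, gradient (Φ n z.1) z.2⟫ +
          2 * ⟪f z.1 z.2, u z.1 z.2⟫ * Φ n z.1 z.2) :=
    ae_all_iff.2 fun n => h.ae_localEnergy_slice hG hu3 hfu (hΦtest n) (hΦ0 n)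
  filter_upwards [hLEI] with s hs hs0
  -- choose `n` with `s ≤ -2 εₙ`
  obtain ⟨n, hn⟩ := exists_nat_one_div_lt (by linarith : 0 < -s / 2)
  have hn' : s ≤ -2 * ε n := by
    have : ε n < -s / 2 := hn
    linarith
  have hsn := hs n
  -- on `{t < s}` the cut-off is `1`
  have hη_one : ∀ t, t < s → η n t = 1 := fun t ht => hη1 n t (by linarith)
  have hslice : ∀ t, t < s → Φ n t = φ t := fun t ht => by
    funext y; simp only [hΦ, hη_one t ht, one_mul]
  have hΦs : ∀ t, t ≤ s → ∀ y, Φ n t y = φ t y := fun t ht y => by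
    simp only [hΦ, hη1 n t (by linarith), one_mul]
  have htd : ∀ t, t < s → ∀ y, timeDeriv (Φ n) t y = timeDeriv φ t y := by
    intro t ht y
    have hev : (fun τ => Φ n τ y) =ᶠ[𝓝 t] fun τ => φ τ y := by
      filter_upwards [Iio_mem_nhds ht] with τ hτ
      exact hΦs τ (le_of_lt hτ) y
    rw [timeDeriv, timeDeriv, hev.deriv_eq]
  have hS : MeasurableSet {z : ℝ × E | z.1 < s} := measurableSet_lt measurable_fst measurable_const
  have e1 : (∫ x, ‖u s x‖ ^ 2 * Φ n s x) = ∫ x, ‖u s x‖ ^ 2 * φ s x := by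
    congr 1; funext x; rw [hΦs s le_rfl x]
  have e2 : ∫ z in {z : ℝ × E | z.1 < s}, frobeniusNormSq (G z.1 z.2) * Φ n z.1 z.2 =
      ∫ z in {z : ℝ × E | z.1 < s}, frobeniusNormSq (G z.1 z.2) * φ z.1 z.2 :=
    setIntegral_congr_fun hS fun z hz => by rw [hΦs z.1 (le_of_lt hz) z.2]
  have e3 : ∫ z in {z : ℝ × E | z.1 < s}, (‖u z.1 z.2‖ ^ 2 *
        (timeDeriv (Φ n) z.1 z.2 + ν * Δ (Φ n z.1) z.2) +
      (‖u z.1 z.2‖ ^ 2 + 2 * p z.1 z.2) * ⟪u z.1 z.2, gradient (Φ n z.1) z.2⟫ +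
      2 * ⟪f z.1 z.2, u z.1 z.2⟫ * Φ n z.1 z.2) =
      ∫ z in {z : ℝ × E | z.1 < s}, (‖u z.1 z.2‖ ^ 2 * (timeDeriv φ z.1 z.2 + ν * Δ (φ z.1) z.2) +
      (‖u z.1 z.2‖ ^ 2 + 2 * p z.1 z.2) * ⟪u z.1 z.2, gradient (φ z.1) z.2⟫ +
      2 * ⟪f z.1 z.2, u z.1 z.2⟫ * φ z.1 z.2) :=
    setIntegral_congr_fun hS fun z hz => by
      have hz' : z.1 < s := hz
      rw [htd z.1 hz' z.2, hslice z.1 hz']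
  rw [e1, e2, e3] at hsn
  exact hsn

end Cutoff

/-! ### Hölder inequalities in the form used below -/

section Holder

variable {α : Type*} [MeasurableSpace α]

/-- `∫ a b ≤ (∫ a^{3/2})^{2/3} (∫ b³)^{1/3}` (Hölder with exponents `3/2` and `3`). [folklore] -/
theorem lintegral_mul_le_threeHalves_three (μ : Measure α) {a b : α → ℝ≥0∞}
    (ha : AEMeasurable a μ) (hb : AEMeasurable b μ) :
    ∫⁻ x, a x * b x ∂μ ≤
      (∫⁻ x, a x ^ (3 / 2 : ℝ) ∂μ) ^ (2 / 3 : ℝ) * (∫⁻ x, b x ^ (3 : ℕ) ∂μ) ^ (1 / 3 : ℝ) := by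
  have hpq : (3 / 2 : ℝ).HolderConjugate 3 := Real.holderConjugate_iff.2 ⟨by norm_num, by norm_num⟩
  have key := ENNReal.lintegral_mul_le_Lp_mul_Lq μ hpq ha hb
  have e3 : ∀ x, b x ^ (3 : ℝ) = b x ^ (3 : ℕ) := fun x => by
    rw [show (3 : ℝ) = ((3 : ℕ) : ℝ) by norm_num, ENNReal.rpow_natCast]
  simp only [Pi.mul_apply, e3] at key
  rw [show (1 : ℝ) / (3 / 2) = 2 / 3 by norm_num] at key
  exact key

/-- `∫ b² ≤ (∫ b³)^{2/3} μ(univ)^{1/3}` (Hölder against the constant `1`). [folklore] -/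
theorem lintegral_sq_le_cube (μ : Measure α) {b : α → ℝ≥0∞} (hb : AEMeasurable b μ) :
    ∫⁻ x, b x ^ (2 : ℕ) ∂μ ≤ (∫⁻ x, b x ^ (3 : ℕ) ∂μ) ^ (2 / 3 : ℝ) * μ univ ^ (1 / 3 : ℝ) := by
  have hpq : (3 / 2 : ℝ).HolderConjugate 3 := Real.holderConjugate_iff.2 ⟨by norm_num, by norm_num⟩
  have key := ENNReal.lintegral_mul_le_Lp_mul_Lq μ hpq (hb.pow_const (2 : ℕ)) (g := fun _ => 1)
    aemeasurable_const
  have e1 : ∀ x, (b x ^ (2 : ℕ)) ^ (3 / 2 : ℝ) = b x ^ (3 : ℕ) := fun x => by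
    rw [← ENNReal.rpow_natCast, ← ENNReal.rpow_mul,
      show ((2 : ℕ) : ℝ) * (3 / 2) = ((3 : ℕ) : ℝ) by norm_num, ENNReal.rpow_natCast]
  simp only [Pi.mul_apply, mul_one, e1, ENNReal.one_rpow, lintegral_const, one_mul] at key
  rw [show (1 : ℝ) / (3 / 2) = 2 / 3 by norm_num] at key
  exact key

/-- `∫ e^{1/2} c^{1/3} ≤ (∫ e)^{1/2} (∫ c)^{1/3}` on a space of measure at most `1` (Hölder with
exponents `2, 2`, then `3/2, 3` against the constant `1`). [folklore] -/
theorem lintegral_sqrt_mul_cbrt_le (μ : Measure α) (hμ : μ univ ≤ 1) {e c : α → ℝ≥0∞}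
    (he : AEMeasurable e μ) (hc : AEMeasurable c μ) :
    ∫⁻ x, e x ^ (1 / 2 : ℝ) * c x ^ (1 / 3 : ℝ) ∂μ ≤
      (∫⁻ x, e x ∂μ) ^ (1 / 2 : ℝ) * (∫⁻ x, c x ∂μ) ^ (1 / 3 : ℝ) := by
  have h22 : (2 : ℝ).HolderConjugate 2 := Real.holderConjugate_iff.2 ⟨by norm_num, by norm_num⟩
  have k1 := ENNReal.lintegral_mul_le_Lp_mul_Lq μ h22 (he.pow_const (1 / 2 : ℝ)) (hc.pow_const (1 / 3 : ℝ))
  have e1 : ∀ x, (e x ^ (1 / 2 : ℝ)) ^ (2 : ℝ) = e x := fun x => by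
    rw [← ENNReal.rpow_mul]; norm_num
  have e2 : ∀ x, (c x ^ (1 / 3 : ℝ)) ^ (2 : ℝ) = c x ^ (2 / 3 : ℝ) := fun x => by
    rw [← ENNReal.rpow_mul]; norm_num
  simp only [Pi.mul_apply, e1, e2] at k1
  -- `∫ c^{2/3} ≤ (∫ c)^{2/3}`
  have h32 : (3 / 2 : ℝ).HolderConjugate 3 := Real.holderConjugate_iff.2 ⟨by norm_num, by norm_num⟩
  have k2 := ENNReal.lintegral_mul_le_Lp_mul_Lq μ h32 (hc.pow_const (2 / 3 : ℝ)) (g := fun _ => 1)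
    aemeasurable_const
  have e3 : ∀ x, (c x ^ (2 / 3 : ℝ)) ^ (3 / 2 : ℝ) = c x := fun x => by
    rw [← ENNReal.rpow_mul, show (2 / 3 : ℝ) * (3 / 2) = 1 by norm_num, ENNReal.rpow_one]
  simp only [Pi.mul_apply, mul_one, e3, ENNReal.one_rpow, lintegral_const, one_mul] at k2
  rw [show (1 : ℝ) / (3 / 2) = 2 / 3 by norm_num] at k2
  have k3 : ∫⁻ x, c x ^ (2 / 3 : ℝ) ∂μ ≤ (∫⁻ x, c x ∂μ) ^ (2 / 3 : ℝ) := by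
    refine k2.trans ?_
    calc (∫⁻ x, c x ∂μ) ^ (2 / 3 : ℝ) * μ univ ^ (1 / 3 : ℝ)
        ≤ (∫⁻ x, c x ∂μ) ^ (2 / 3 : ℝ) * 1 ^ (1 / 3 : ℝ) := by gcongr
      _ = (∫⁻ x, c x ∂μ) ^ (2 / 3 : ℝ) := by rw [ENNReal.one_rpow, mul_one]
  refine k1.trans ?_
  gcongr ?_ * ?_
  · exact le_rfl
  · calc (∫⁻ x, c x ^ (2 / 3 : ℝ) ∂μ) ^ (1 / 2 : ℝ) ≤ ((∫⁻ x, c x ∂μ) ^ (2 / 3 : ℝ)) ^ (1 / 2 : ℝ) :=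
          ENNReal.rpow_le_rpow k3 (by norm_num)
      _ = (∫⁻ x, c x ∂μ) ^ (1 / 3 : ℝ) := by rw [← ENNReal.rpow_mul]; norm_num

end Holder

/-! ### The mean-zero cubic term on one slice -/

section Slice

variable {E : Type*} [NormedAddCommGroup E] [InnerProductSpace ℝ E] [FiniteDimensional ℝ E]
  [MeasurableSpace E] [BorelSpace E]

/-- **The mean-subtracted cubic term on one time slice** (Robinson–Rodrigo–Sadowski 2016,
display after (16.6), p. 241): in three space dimensions there is an absolute `C₄` such that for
every `v ∈ W^{1,2}(B₁; E)` on the unit ball with weak derivative `Gv`,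
`∫_{B₁} ||v|² - (|v|²)_{B₁}| |v| ≤ C₄ ‖v‖_{L²(B₁)} ‖Gv‖_{L²(B₁)} ‖v‖_{L³(B₁)}`
(Hölder `3/2, 3`, the Sobolev–Poincaré inequality `W^{1,1} ⊂ L^{3/2}` for the mean-zero function
`|v|² - (|v|²)_{B₁}`, whose weak gradient `2 vᵀ Gv` has `L¹` norm at most `2‖v‖₂‖Gv‖₂`).
[cite: RobinsonRodrigoSadowski2016, proof of Thm. 16.1 p. 241] -/
theorem exists_meanZero_cubic_slice_le (hE3 : finrank ℝ E = 3) :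
    ∃ C₄ : ℝ≥0, ∀ (v : E → E) (Gv : E → E →L[ℝ] E),
      FunctionSpaces.MemSobolevDomain 1 2 (⟨ball (0 : E) 1, isOpen_ball⟩ : Opens E) volume v →
      FunctionSpaces.HasWeakFDerivOn (⟨ball (0 : E) 1, isOpen_ball⟩ : Opens E) volume v Gv →
      ∫⁻ x in ball (0 : E) 1, ‖‖v x‖ ^ 2 - ⨍ y in ball (0 : E) 1, ‖v y‖ ^ 2‖ₑ * ‖v x‖ₑ ≤
        C₄ * eLpNorm v 2 (volume.restrict (ball (0 : E) 1)) *
          eLpNorm Gv 2 (volume.restrict (ball (0 : E) 1)) *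
          (∫⁻ x in ball (0 : E) 1, ‖v x‖ₑ ^ (3 : ℕ)) ^ (1 / 3 : ℝ) := by
  obtain ⟨CSP, hSP⟩ := FunctionSpaces.exists_eLpNorm_sub_average_le_unitBall (E' := E) hE3
  refine ⟨2 * CSP, fun v Gv hv hGv => ?_⟩
  set B : Opens E := ⟨ball (0 : E) 1, isOpen_ball⟩ with hB
  set μ : Measure E := volume.restrict (ball (0 : E) 1) with hμ
  have hBL : FunctionSpaces.IsLipschitzDomain B := FunctionSpaces.isLipschitzDomain_ball (0 : E) 1
  have hBb : Bornology.IsBounded (B : Set E) := isBounded_ball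
  set α : ℝ := ⨍ y in ball (0 : E) 1, ‖v y‖ ^ 2 with hα
  set g : E → ℝ := fun x => ‖v x‖ ^ 2 with hg
  set Dg : E → E →L[ℝ] ℝ := fun x => (2 : ℝ) • (innerSL ℝ (v x)).comp (Gv x) with hDg
  have hvm : AEStronglyMeasurable v μ := hv.memLp.1
  have hGm : AEStronglyMeasurable Gv μ := hGv.locallyIntegrableOn_deriv.aestronglyMeasurable
  -- Hölder `3/2, 3`
  have hgm : AEMeasurable (fun x => g x - α) μ := (hvm.norm.aemeasurable.pow_const 2).sub_const α
  have hH := lintegral_mul_le_threeHalves_three μ (a := fun x => ‖g x - α‖ₑ) (b := fun x => ‖v x‖ₑ)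
    hgm.enorm hvm.enorm
  -- `(∫ |g - α|^{3/2})^{2/3} = ‖g - α‖_{L^{3/2}}`
  have h32 : (∫⁻ x, ‖g x - α‖ₑ ^ (3 / 2 : ℝ) ∂μ) ^ (2 / 3 : ℝ) =
      eLpNorm (fun x => g x - α) (3 / 2 : ℝ≥0∞) μ := by
    rw [eLpNorm_eq_lintegral_rpow_enorm_toReal (by norm_num)
      (ENNReal.div_ne_top (by norm_num) (by norm_num)), ENNReal.toReal_div]
    norm_num
  -- Sobolev–Poincaré for `g = |v|²`
  have hg1 : FunctionSpaces.MemSobolevDomain 1 1 B volume g :=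
    FunctionSpaces.memSobolevDomain_one_one_norm_sq hBL hBb hv hGv
  have hDgw : FunctionSpaces.HasWeakFDerivOn B volume g Dg := hGv.norm_sq hBL hBb hv
  have hSPg := hSP g Dg hg1 hDgw
  have hD1 : eLpNorm Dg 1 μ ≤ 2 * eLpNorm v 2 μ * eLpNorm Gv 2 μ :=
    FunctionSpaces.eLpNorm_two_smul_innerSL_comp_le hvm hGm
  calc ∫⁻ x in ball (0 : E) 1, ‖‖v x‖ ^ 2 - ⨍ y in ball (0 : E) 1, ‖v y‖ ^ 2‖ₑ * ‖v x‖ₑ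
      ≤ (∫⁻ x, ‖g x - α‖ₑ ^ (3 / 2 : ℝ) ∂μ) ^ (2 / 3 : ℝ) * (∫⁻ x, ‖v x‖ₑ ^ (3 : ℕ) ∂μ) ^ (1 / 3 : ℝ) := hH
    _ = eLpNorm (fun x => g x - α) (3 / 2 : ℝ≥0∞) μ * (∫⁻ x, ‖v x‖ₑ ^ (3 : ℕ) ∂μ) ^ (1 / 3 : ℝ) := by
        rw [h32]
    _ ≤ (CSP * eLpNorm Dg 1 μ) * (∫⁻ x, ‖v x‖ₑ ^ (3 : ℕ) ∂μ) ^ (1 / 3 : ℝ) := by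
        gcongr
    _ ≤ (CSP * (2 * eLpNorm v 2 μ * eLpNorm Gv 2 μ)) * (∫⁻ x, ‖v x‖ₑ ^ (3 : ℕ) ∂μ) ^ (1 / 3 : ℝ) := by
        gcongr
    _ = ((2 * CSP : ℝ≥0) : ℝ≥0∞) * eLpNorm v 2 μ * eLpNorm Gv 2 μ *
          (∫⁻ x, ‖v x‖ₑ ^ (3 : ℕ) ∂μ) ^ (1 / 3 : ℝ) := by
        push_cast; ring

end Slice

/-! ### The final algebra: Young's inequality and the interpolation inequality -/

section Algebra

/-- Young's inequality `xy ≤ x²/2 + y²/2` in `ℝ≥0∞`. [folklore] -/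
theorem ENNReal.mul_le_half_sq_add_half_sq (x y : ℝ≥0∞) :
    x * y ≤ x ^ (2 : ℝ) / 2 + y ^ (2 : ℝ) / 2 := by
  have h := ENNReal.young_inequality x y (Real.holderConjugate_iff.2 ⟨by norm_num, by norm_num⟩ :
    (2 : ℝ).HolderConjugate 2)
  simpa using h

/-- The splitting used three times: `(θ c)(k m) ≤ ½ θ² c² + ½ k² m²` with `c = C^{1/3}`,
in the form `ofReal a * m * C^{1/3} ≤ ofReal(θ²)/2 * C^{2/3} + ofReal((a/θ)²)/2 * m²`
for `a ≥ 0`, `θ > 0`. [folklore] -/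
theorem split_young {θ a : ℝ} (hθ : 0 < θ) (ha : 0 ≤ a) (m C : ℝ≥0∞) :
    ENNReal.ofReal a * m * C ^ (1 / 3 : ℝ) ≤
      ENNReal.ofReal (θ ^ 2) / 2 * C ^ (2 / 3 : ℝ) + ENNReal.ofReal ((a / θ) ^ 2) / 2 * m ^ (2 : ℝ) := by
  have key := ENNReal.mul_le_half_sq_add_half_sq (ENNReal.ofReal θ * C ^ (1 / 3 : ℝ))
    (ENNReal.ofReal (a / θ) * m)
  have e0 : ENNReal.ofReal a * m * C ^ (1 / 3 : ℝ) =
      ENNReal.ofReal θ * C ^ (1 / 3 : ℝ) * (ENNReal.ofReal (a / θ) * m) := by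
    rw [show ENNReal.ofReal a = ENNReal.ofReal θ * ENNReal.ofReal (a / θ) by
      rw [← ENNReal.ofReal_mul hθ.le]; congr 1; field_simp]
    ring
  rw [e0]
  refine key.trans (le_of_eq ?_)
  rw [ENNReal.mul_rpow_of_nonneg _ _ (by norm_num : (0 : ℝ) ≤ 2),
    ENNReal.mul_rpow_of_nonneg _ _ (by norm_num : (0 : ℝ) ≤ 2), ← ENNReal.rpow_mul,
    ENNReal.ofReal_rpow_of_nonneg hθ.le (by norm_num),
    ENNReal.ofReal_rpow_of_nonneg (div_nonneg ha hθ.le) (by norm_num),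
    show (θ : ℝ) ^ (2 : ℝ) = θ ^ 2 by norm_cast, show (a / θ : ℝ) ^ (2 : ℝ) = (a / θ) ^ 2 by norm_cast]
  norm_num
  simp only [div_eq_mul_inv]
  ring

/-- `ofReal a · (ofReal b / 2) = ofReal (a b / 2)` for `a ≥ 0`. [folklore] -/
theorem ofReal_mul_ofReal_div_two {a b : ℝ} (ha : 0 ≤ a) :
    ENNReal.ofReal a * (ENNReal.ofReal b / 2) = ENNReal.ofReal (a * b / 2) := by
  rw [← mul_div_assoc, ← ENNReal.ofReal_mul ha, ENNReal.ofReal_div_of_pos (by norm_num : (0:ℝ) < 2)]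
  simp

/-- **The algebra of (16.6)–(16.13)**: from the bound of `X = A(θ) + E(θ)` by the four
integral terms (with `C = C(1)`, `A = A(1)`, `E`, `D`, `F = F_q(1)`), Young's inequality
(`split_young`) and the interpolation inequality `C ≤ C₀ (A + E)^{3/2}` give the form of the
decomposition target, with coefficients `ofReal` of absolute real constants times the powers
`θ²`, `θ⁻⁶`, `θ⁻⁶`, `θ⁻⁴` (Robinson–Rodrigo–Sadowski 2016, (16.6)–(16.7) and (16.13)).
[cite: RobinsonRodrigoSadowski2016, (16.13)] -/
theorem localEnergy_algebra {θ : ℝ} (hθ : 0 < θ) {cT c1 C4 c2 : ℝ} (hcT : 0 ≤ cT) (hc1 : 0 ≤ c1)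
    (hC4 : 0 ≤ C4) (hc2 : 0 ≤ c2) {C0 : ℝ≥0} {q : ℝ} (hq : 0 < q) {A E C D F X : ℝ≥0∞}
    (hC : C ≤ C0 * (A + E) ^ (3 / 2 : ℝ))
    (hX : X ≤ ENNReal.ofReal (2 * cT) *
      (ENNReal.ofReal (cT * θ ^ 2 * c1) * C ^ (2 / 3 : ℝ) +
        ENNReal.ofReal (cT * C4 * (θ ^ 2)⁻¹) * (A * E) ^ (1 / 2 : ℝ) * C ^ (1 / 3 : ℝ) +
        ENNReal.ofReal (2 * cT * (θ ^ 2)⁻¹) * D ^ (2 / 3 : ℝ) * C ^ (1 / 3 : ℝ) +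
        ENNReal.ofReal (2 * cT * c2 * θ⁻¹) * F ^ (1 / q) * C ^ (1 / 3 : ℝ))) :
    X ≤ ENNReal.ofReal (2 * cT * (cT * c1 + 3 / 2)) * ENNReal.ofReal (θ ^ 2) *
          ((C0 : ℝ≥0∞) ^ (2 / 3 : ℝ) * (A + E)) +
        ENNReal.ofReal (cT * (cT * C4) ^ 2) * ENNReal.ofReal ((θ ^ 6)⁻¹) * (A * E) +
        ENNReal.ofReal (cT * (2 * cT) ^ 2) * ENNReal.ofReal ((θ ^ 6)⁻¹) * D ^ (4 / 3 : ℝ) +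
        ENNReal.ofReal (cT * (2 * cT * c2) ^ 2) * ENNReal.ofReal ((θ ^ 4)⁻¹) * F ^ (2 / q) := by
  -- the three Young splittings
  have y2 := split_young hθ (by positivity : 0 ≤ cT * C4 * (θ ^ 2)⁻¹) ((A * E) ^ (1 / 2 : ℝ)) C
  have y3 := split_young hθ (by positivity : 0 ≤ 2 * cT * (θ ^ 2)⁻¹) (D ^ (2 / 3 : ℝ)) C
  have y4 := split_young hθ (by positivity : 0 ≤ 2 * cT * c2 * θ⁻¹) (F ^ (1 / q)) C
  -- the squared `m`'s
  have m2 : ((A * E) ^ (1 / 2 : ℝ)) ^ (2 : ℝ) = A * E := by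
    rw [← ENNReal.rpow_mul]; norm_num
  have m3 : (D ^ (2 / 3 : ℝ)) ^ (2 : ℝ) = D ^ (4 / 3 : ℝ) := by
    rw [← ENNReal.rpow_mul]; norm_num
  have m4 : (F ^ (1 / q)) ^ (2 : ℝ) = F ^ (2 / q) := by
    rw [← ENNReal.rpow_mul]; congr 1; field_simp
  rw [m2] at y2
  rw [m3] at y3
  rw [m4] at y4
  -- the interpolation inequality in the form `C^{2/3} ≤ C₀^{2/3} (A + E)`
  have hC23 : C ^ (2 / 3 : ℝ) ≤ (C0 : ℝ≥0∞) ^ (2 / 3 : ℝ) * (A + E) := by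
    calc C ^ (2 / 3 : ℝ) ≤ ((C0 : ℝ≥0∞) * (A + E) ^ (3 / 2 : ℝ)) ^ (2 / 3 : ℝ) :=
          ENNReal.rpow_le_rpow hC (by norm_num)
      _ = (C0 : ℝ≥0∞) ^ (2 / 3 : ℝ) * (A + E) := by
          rw [ENNReal.mul_rpow_of_nonneg _ _ (by norm_num), ← ENNReal.rpow_mul]
          norm_num
  -- collect
  have step : X ≤ ENNReal.ofReal (2 * cT) *
      ((ENNReal.ofReal (cT * θ ^ 2 * c1) + 3 * (ENNReal.ofReal (θ ^ 2) / 2)) * C ^ (2 / 3 : ℝ) +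
        ENNReal.ofReal ((cT * C4 * (θ ^ 2)⁻¹ / θ) ^ 2) / 2 * (A * E) +
        ENNReal.ofReal ((2 * cT * (θ ^ 2)⁻¹ / θ) ^ 2) / 2 * D ^ (4 / 3 : ℝ) +
        ENNReal.ofReal ((2 * cT * c2 * θ⁻¹ / θ) ^ 2) / 2 * F ^ (2 / q)) := by
    refine hX.trans ?_
    gcongr ?_ * ?_
    · exact le_rfl
    calc _ ≤ ENNReal.ofReal (cT * θ ^ 2 * c1) * C ^ (2 / 3 : ℝ) +
          (ENNReal.ofReal (θ ^ 2) / 2 * C ^ (2 / 3 : ℝ) +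
            ENNReal.ofReal ((cT * C4 * (θ ^ 2)⁻¹ / θ) ^ 2) / 2 * (A * E)) +
          (ENNReal.ofReal (θ ^ 2) / 2 * C ^ (2 / 3 : ℝ) +
            ENNReal.ofReal ((2 * cT * (θ ^ 2)⁻¹ / θ) ^ 2) / 2 * D ^ (4 / 3 : ℝ)) +
          (ENNReal.ofReal (θ ^ 2) / 2 * C ^ (2 / 3 : ℝ) +
            ENNReal.ofReal ((2 * cT * c2 * θ⁻¹ / θ) ^ 2) / 2 * F ^ (2 / q)) := by
          gcongr
      _ = _ := by ring
  refine step.trans ?_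
  -- replace `C^{2/3}` and identify the coefficients
  have hθ2 : 0 < θ ^ 2 := by positivity
  have e1 : ENNReal.ofReal (2 * cT) * (ENNReal.ofReal (cT * θ ^ 2 * c1) + 3 * (ENNReal.ofReal (θ ^ 2) / 2)) =
      ENNReal.ofReal (2 * cT * (cT * c1 + 3 / 2)) * ENNReal.ofReal (θ ^ 2) := by
    rw [show (3 : ℝ≥0∞) * (ENNReal.ofReal (θ ^ 2) / 2) = ENNReal.ofReal (3 * (θ ^ 2 / 2)) by
        rw [ENNReal.ofReal_mul (by norm_num), ENNReal.ofReal_div_of_pos (by norm_num)]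
        simp,
      ← ENNReal.ofReal_add (by positivity) (by positivity), ← ENNReal.ofReal_mul (by positivity),
      ← ENNReal.ofReal_mul (by positivity)]
    congr 1; ring
  have e2 : ENNReal.ofReal (2 * cT) * (ENNReal.ofReal ((cT * C4 * (θ ^ 2)⁻¹ / θ) ^ 2) / 2) =
      ENNReal.ofReal (cT * (cT * C4) ^ 2) * ENNReal.ofReal ((θ ^ 6)⁻¹) := by
    rw [ofReal_mul_ofReal_div_two (by positivity), ← ENNReal.ofReal_mul (by positivity)]
    congr 1; field_simp
  have e3 : ENNReal.ofReal (2 * cT) * (ENNReal.ofReal ((2 * cT * (θ ^ 2)⁻¹ / θ) ^ 2) / 2) =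
      ENNReal.ofReal (cT * (2 * cT) ^ 2) * ENNReal.ofReal ((θ ^ 6)⁻¹) := by
    rw [ofReal_mul_ofReal_div_two (by positivity), ← ENNReal.ofReal_mul (by positivity)]
    congr 1; field_simp
  have e4 : ENNReal.ofReal (2 * cT) * (ENNReal.ofReal ((2 * cT * c2 * θ⁻¹ / θ) ^ 2) / 2) =
      ENNReal.ofReal (cT * (2 * cT * c2) ^ 2) * ENNReal.ofReal ((θ ^ 4)⁻¹) := by
    rw [ofReal_mul_ofReal_div_two (by positivity), ← ENNReal.ofReal_mul (by positivity)]
    congr 1; field_simp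
  calc ENNReal.ofReal (2 * cT) *
      ((ENNReal.ofReal (cT * θ ^ 2 * c1) + 3 * (ENNReal.ofReal (θ ^ 2) / 2)) * C ^ (2 / 3 : ℝ) +
        ENNReal.ofReal ((cT * C4 * (θ ^ 2)⁻¹ / θ) ^ 2) / 2 * (A * E) +
        ENNReal.ofReal ((2 * cT * (θ ^ 2)⁻¹ / θ) ^ 2) / 2 * D ^ (4 / 3 : ℝ) +
        ENNReal.ofReal ((2 * cT * c2 * θ⁻¹ / θ) ^ 2) / 2 * F ^ (2 / q))
      = (ENNReal.ofReal (2 * cT) * (ENNReal.ofReal (cT * θ ^ 2 * c1) + 3 * (ENNReal.ofReal (θ ^ 2) / 2))) *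
          C ^ (2 / 3 : ℝ) +
        ENNReal.ofReal (2 * cT) * (ENNReal.ofReal ((cT * C4 * (θ ^ 2)⁻¹ / θ) ^ 2) / 2) * (A * E) +
        ENNReal.ofReal (2 * cT) * (ENNReal.ofReal ((2 * cT * (θ ^ 2)⁻¹ / θ) ^ 2) / 2) * D ^ (4 / 3 : ℝ) +
        ENNReal.ofReal (2 * cT) * (ENNReal.ofReal ((2 * cT * c2 * θ⁻¹ / θ) ^ 2) / 2) * F ^ (2 / q) := by
        ring
    _ ≤ _ := by
        rw [e1, e2, e3, e4]
        gcongr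

end Algebra

/-! ### Extracting bounds valid for a.e. `s < 0` -/

section Extraction

/-- From an a.e. statement in negative times one can pick good times arbitrarily close to `0`. [folklore] -/
theorem exists_seq_tendsto_zero_of_ae_neg {P : ℝ → Prop}
    (h : ∀ᵐ s ∂(volume : Measure ℝ), s < 0 → P s) :
    ∃ s : ℕ → ℝ, (∀ j, s j < 0) ∧ (∀ j : ℕ, -(1 / ((j : ℝ) + 1)) < s j) ∧ ∀ j, P (s j) := by
  have hj : ∀ j : ℕ, ∃ s, s < 0 ∧ -(1 / ((j : ℝ) + 1)) < s ∧ P s := by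
    intro j
    by_contra hne
    have hsub : Ioo (-(1 / ((j : ℝ) + 1))) 0 ⊆ {s | ¬(s < 0 → P s)} := by
      intro s hs hs'
      exact hne ⟨s, hs.2, hs.1, hs' hs.2⟩
    have h0 : (volume : Measure ℝ) {s | ¬(s < 0 → P s)} = 0 := ae_iff.1 h
    have hpos : 0 < (volume : Measure ℝ) (Ioo (-(1 / ((j : ℝ) + 1))) 0) := by
      rw [Real.volume_Ioo]
      have : (0 : ℝ) < 1 / ((j : ℝ) + 1) := Nat.one_div_pos_of_nat
      exact ENNReal.ofReal_pos.2 (by linarith)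
    exact (lt_of_lt_of_le hpos ((measure_mono hsub).trans h0.le)).ne rfl
  choose s hs0 hsj hP using hj
  exact ⟨s, hs0, hsj, hP⟩

variable {X : Type*} [MeasurableSpace X]

/-- **From bounds below a.e. negative time to the bound up to time `0`.** Let `T` be a set of
space–time points with negative times and `F ≥ 0`. If for a.e. `s < 0` the integral of `F`
over `T ∩ {t < s}` is at most `Y`, then so is the integral over `T` (exhaust `T` by the
increasing family `T ∩ {t < sⱼ}` along good times `sⱼ ↑ 0`; Robinson–Rodrigo–Sadowski 2016,
p. 242: "letting `t = 0` in the second"). [folklore] -/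
theorem setLIntegral_le_of_ae_neg_time {μ : Measure (ℝ × X)} {T : Set (ℝ × X)}
    (hT : ∀ z ∈ T, z.1 < 0) {F : ℝ × X → ℝ≥0∞} {Y : ℝ≥0∞}
    (h : ∀ᵐ s ∂(volume : Measure ℝ), s < 0 → ∫⁻ z in T ∩ {z | z.1 < s}, F z ∂μ ≤ Y) :
    ∫⁻ z in T, F z ∂μ ≤ Y := by
  obtain ⟨s, hs0, hsj, hP⟩ := exists_seq_tendsto_zero_of_ae_neg h
  -- every negative time is eventually below some `s j`
  have hcof : ∀ t : ℝ, t < 0 → ∃ j, t < s j := by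
    intro t ht
    obtain ⟨j, hj⟩ := exists_nat_one_div_lt (by linarith : 0 < -t)
    exact ⟨j, by linarith [hsj j]⟩
  have hdir : Directed (· ⊆ ·) fun j => T ∩ {z : ℝ × X | z.1 < s j} := by
    intro j₁ j₂
    obtain ⟨j, hj⟩ := hcof (max (s j₁) (s j₂)) (max_lt (hs0 j₁) (hs0 j₂))
    refine ⟨j, fun z hz => ⟨hz.1, ?_⟩, fun z hz => ⟨hz.1, ?_⟩⟩
    · exact lt_trans (lt_of_lt_of_le hz.2 (le_max_left _ _)) hj
    · exact lt_trans (lt_of_lt_of_le hz.2 (le_max_right _ _)) hj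
  have hU : (⋃ j, T ∩ {z : ℝ × X | z.1 < s j}) = T := by
    refine subset_antisymm (iUnion_subset fun j => inter_subset_left) fun z hz => ?_
    obtain ⟨j, hj⟩ := hcof z.1 (hT z hz)
    exact mem_iUnion.2 ⟨j, hz, hj⟩
  rw [← hU, setLIntegral_iUnion_of_directed _ hdir]
  exact iSup_le fun j => hP j

end Extraction

/-! ### Pointwise and integrability facts for the right-hand side -/

section RHS

variable {E : Type*} [NormedAddCommGroup E] [InnerProductSpace ℝ E]

/-- **Pointwise bound of the (mean-subtracted) right-hand integrand** by the four terms of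
Robinson–Rodrigo–Sadowski 2016, (16.6) and p. 242, given the bounds on the weight:
`|φₜ + Δφ| ≤ c θ²`, `|∇φ| ≤ c θ⁻²`, `0 ≤ φ ≤ c θ⁻¹`. [cite: RobinsonRodrigoSadowski2016, (16.6)] -/
theorem abs_rhs_le {v g w : E} {π a φv d c θ : ℝ} (hd : |d| ≤ c * θ ^ 2)
    (hg : ‖g‖ ≤ c * (θ ^ 2)⁻¹) (hφ0 : 0 ≤ φv) (hφ1 : φv ≤ c * θ⁻¹) :
    |‖v‖ ^ 2 * d + (‖v‖ ^ 2 - a + 2 * π) * ⟪v, g⟫ + 2 * ⟪w, v⟫ * φv| ≤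
      c * θ ^ 2 * ‖v‖ ^ 2 + c * (θ ^ 2)⁻¹ * (|‖v‖ ^ 2 - a| * ‖v‖) +
        2 * c * (θ ^ 2)⁻¹ * (|π| * ‖v‖) + 2 * c * θ⁻¹ * (‖w‖ * ‖v‖) := by
  have hvg : |⟪v, g⟫| ≤ ‖v‖ * (c * (θ ^ 2)⁻¹) :=
    (abs_real_inner_le_norm v g).trans (mul_le_mul_of_nonneg_left hg (norm_nonneg _))
  have hwv : |⟪w, v⟫| ≤ ‖w‖ * ‖v‖ := abs_real_inner_le_norm w v
  have h1 : |‖v‖ ^ 2 * d| ≤ c * θ ^ 2 * ‖v‖ ^ 2 := by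
    rw [abs_mul, abs_of_nonneg (sq_nonneg _)]
    nlinarith [sq_nonneg ‖v‖, abs_nonneg d]
  have h2 : |(‖v‖ ^ 2 - a + 2 * π) * ⟪v, g⟫| ≤
      c * (θ ^ 2)⁻¹ * (|‖v‖ ^ 2 - a| * ‖v‖) + 2 * c * (θ ^ 2)⁻¹ * (|π| * ‖v‖) := by
    rw [abs_mul]
    have h3 : |‖v‖ ^ 2 - a + 2 * π| ≤ |‖v‖ ^ 2 - a| + 2 * |π| := by
      calc |‖v‖ ^ 2 - a + 2 * π| ≤ |‖v‖ ^ 2 - a| + |2 * π| := abs_add_le _ _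
        _ = |‖v‖ ^ 2 - a| + 2 * |π| := by rw [abs_mul, abs_two]
    calc |‖v‖ ^ 2 - a + 2 * π| * |⟪v, g⟫| ≤ (|‖v‖ ^ 2 - a| + 2 * |π|) * (‖v‖ * (c * (θ ^ 2)⁻¹)) :=
          mul_le_mul h3 hvg (abs_nonneg _) (by positivity)
      _ = _ := by ring
  have h4 : |2 * ⟪w, v⟫ * φv| ≤ 2 * c * θ⁻¹ * (‖w‖ * ‖v‖) := by
    rw [abs_mul, abs_mul, abs_two, abs_of_nonneg hφ0]
    calc 2 * |⟪w, v⟫| * φv ≤ 2 * (‖w‖ * ‖v‖) * (c * θ⁻¹) :=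
          mul_le_mul (mul_le_mul_of_nonneg_left hwv (by norm_num)) hφ1 hφ0 (by positivity)
      _ = _ := by ring
  calc _ ≤ |‖v‖ ^ 2 * d + (‖v‖ ^ 2 - a + 2 * π) * ⟪v, g⟫| + |2 * ⟪w, v⟫ * φv| := abs_add_le _ _
    _ ≤ (|‖v‖ ^ 2 * d| + |(‖v‖ ^ 2 - a + 2 * π) * ⟪v, g⟫|) + |2 * ⟪w, v⟫ * φv| := by
        gcongr; exact abs_add_le _ _
    _ ≤ _ := by linarith

/-- `b^{q'} ≤ 1 + b³` for `0 ≤ b` and `0 ≤ q' ≤ 3`. [folklore] -/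
theorem rpow_le_one_add_pow_three {b q' : ℝ} (hb : 0 ≤ b) (hq0 : 0 ≤ q') (hq3 : q' ≤ 3) :
    b ^ q' ≤ 1 + b ^ 3 := by
  rcases le_or_gt b 1 with h | h
  · calc b ^ q' ≤ 1 := Real.rpow_le_one hb h hq0
      _ ≤ 1 + b ^ 3 := by linarith [pow_nonneg hb 3]
  · calc b ^ q' ≤ b ^ (3 : ℝ) := Real.rpow_le_rpow_of_exponent_le h.le hq3
      _ = b ^ 3 := by rw [show (3 : ℝ) = ((3 : ℕ) : ℝ) by norm_num, Real.rpow_natCast]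
      _ ≤ 1 + b ^ 3 := by linarith

end RHS

/-! ### Integrability of `f · u` and the mean-zero cubic term at unit scale -/

section UnitScale

variable {E : Type*} [NormedAddCommGroup E] [InnerProductSpace ℝ E]

/-- **`f · u ∈ L¹`** when `f ∈ L^q`, `q ≥ 3/2`, and `u ∈ L³` on a finite measure space (Young:
`|f||u| ≤ |f|^q + |u|^{q'} ≤ |f|^q + 1 + |u|³`, `q' ≤ 3`; Caffarelli–Kohn–Nirenberg 1982, §2,
the term `∫∫ (u·f) φ` in (2.5)). [cite: CaffarelliKohnNirenberg1982, §2 (2.5)] -/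
theorem integrable_inner_of_memLp_of_lintegral_cube {α : Type*} [MeasurableSpace α] (μ : Measure α)
    [IsFiniteMeasure μ] [MeasurableSpace E] [BorelSpace E] [SecondCountableTopology E] {q : ℝ}
    (hq : 3 / 2 ≤ q) {f u : α → E} (hf : MemLp f (ENNReal.ofReal q) μ)
    (hum : AEStronglyMeasurable u μ) (hu3 : ∫⁻ x, ‖u x‖ₑ ^ (3 : ℕ) ∂μ < ∞) :
    Integrable (fun x => ⟪f x, u x⟫) μ := by
  have hq1 : 1 < q := by linarith
  have hq0 : 0 < q := by linarith
  set q' : ℝ := q.conjExponent with hq'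
  have hqq' : q.HolderConjugate q' := Real.HolderConjugate.conjExponent hq1
  have hq'1 : 1 < q' := hqq'.symm.lt
  have hq'3 : q' ≤ 3 := by
    have h1 : q' = q / (q - 1) := rfl
    rw [h1, div_le_iff₀ (by linarith)]
    linarith
  -- the dominating function
  have hfq : Integrable (fun x => ‖f x‖ ^ q) μ := by
    have := hf.integrable_norm_rpow (by simp [hq0]) ENNReal.ofReal_ne_top
    simpa [ENNReal.toReal_ofReal hq0.le] using this
  have hu3' : Integrable (fun x => ‖u x‖ ^ 3) μ := by
    refine ⟨(hum.norm.pow 3), ?_⟩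
    rw [hasFiniteIntegral_iff_enorm]
    refine lt_of_le_of_lt (lintegral_mono fun x => ?_) hu3
    rw [Real.enorm_eq_ofReal (by positivity), ENNReal.ofReal_pow (norm_nonneg _), ofReal_norm]
  have hdom : Integrable (fun x => ‖f x‖ ^ q + (1 + ‖u x‖ ^ 3)) μ :=
    hfq.add ((integrable_const 1).add hu3')
  refine hdom.mono' (hf.1.inner hum) (Eventually.of_forall fun x => ?_)
  have hy := Real.young_inequality_of_nonneg (norm_nonneg (f x)) (norm_nonneg (u x)) hqq'
  have h1 : ‖f x‖ ^ q / q ≤ ‖f x‖ ^ q := div_le_self (by positivity) hq1.le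
  have h2 : ‖u x‖ ^ q' / q' ≤ 1 + ‖u x‖ ^ 3 :=
    (div_le_self (by positivity) hq'1.le).trans
      (rpow_le_one_add_pow_three (norm_nonneg _) (by linarith) hq'3)
  calc ‖⟪f x, u x⟫‖ = |⟪f x, u x⟫| := Real.norm_eq_abs _
    _ ≤ ‖f x‖ * ‖u x‖ := abs_real_inner_le_norm _ _
    _ ≤ _ := hy.trans (add_le_add h1 h2)

/-- **The mean-subtracted cubic term at unit scale** (Robinson–Rodrigo–Sadowski 2016, p. 241,
second display, integrated over `t ∈ (-1, 0)` with Hölder in time): there is an absolute `C₄`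
with `∫∫_{Q₁} ||u|² - (|u|²)_{B₁}(t)| |u| ≤ C₄ (A(1) E(1))^{1/2} C(1)^{1/3}` for every `u` with
weak spatial gradient `G` on `Q₁(0)` and `A(1), E(1) < ∞`. [cite: RobinsonRodrigoSadowski2016, proof of Thm. 16.1 p. 241] -/
theorem exists_lintegral_meanZero_cubic_le :
    ∃ C₄ : ℝ≥0, ∀ (u : ℝ → EuclideanSpace ℝ (Fin 3) → EuclideanSpace ℝ (Fin 3))
      (G : ℝ → EuclideanSpace ℝ (Fin 3) → EuclideanSpace ℝ (Fin 3) →L[ℝ] EuclideanSpace ℝ (Fin 3)),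
      HasWeakSpatialGradientOn (parabolicCylinderOpens 1 0) u G →
      cknAEss 1 0 u ≠ ∞ → cknE 1 0 G ≠ ∞ →
      ∫⁻ z in Ioo (-1 : ℝ) 0 ×ˢ ball (0 : EuclideanSpace ℝ (Fin 3)) 1,
          ‖‖u z.1 z.2‖ ^ 2 - ⨍ y in ball (0 : EuclideanSpace ℝ (Fin 3)) 1, ‖u z.1 y‖ ^ 2‖ₑ *
            ‖u z.1 z.2‖ₑ ≤
        C₄ * (cknAEss 1 0 u * cknE 1 0 G) ^ (1 / 2 : ℝ) * cknC 1 0 u ^ (1 / 3 : ℝ) := by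
  obtain ⟨C₄, hC₄⟩ := exists_meanZero_cubic_slice_le (E := EuclideanSpace ℝ (Fin 3))
    finrank_euclideanSpace_fin
  refine ⟨C₄, fun u G h hA hE => ?_⟩
  set B : Set (EuclideanSpace ℝ (Fin 3)) := ball 0 1 with hB
  set I : Set ℝ := Ioo (-1) 0 with hI
  set a : ℝ → ℝ≥0∞ := fun t => ∫⁻ x in B, ‖u t x‖ₑ ^ 2 with ha
  set e : ℝ → ℝ≥0∞ := fun t => ∫⁻ x in B, ENNReal.ofReal (frobeniusNormSq (G t x)) with he
  set c : ℝ → ℝ≥0∞ := fun t => ∫⁻ x in B, ‖u t x‖ₑ ^ (3 : ℕ) with hc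
  set H : ℝ × EuclideanSpace ℝ (Fin 3) → ℝ≥0∞ := fun z =>
    ‖‖u z.1 z.2‖ ^ 2 - ⨍ y in B, ‖u z.1 y‖ ^ 2‖ₑ * ‖u z.1 z.2‖ₑ with hH
  have hQ : parabolicCylinder 1 (0 : ℝ × EuclideanSpace ℝ (Fin 3)) = I ×ˢ B := by
    simp [parabolicCylinder, hI, hB]
  have hQI : Ioo ((0 : ℝ × EuclideanSpace ℝ (Fin 3)).1 - 1 ^ 2) (0 : ℝ × EuclideanSpace ℝ (Fin 3)).1 = I := by
    simp [hI]
  have hAeq : cknAEss 1 0 u = essSup a (volume.restrict I) := by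
    simp only [cknAEss, ENNReal.ofReal_one, inv_one, one_mul, hQI]
    rfl
  have hEeq : cknE 1 0 G = ∫⁻ q in I ×ˢ B, ENNReal.ofReal (frobeniusNormSq (G q.1 q.2)) := by
    simp only [cknE, ENNReal.ofReal_one, inv_one, one_mul, hQ]
  have hCeq : cknC 1 0 u = ∫⁻ q in I ×ˢ B, ‖u q.1 q.2‖ₑ ^ (3 : ℕ) := by
    simp only [cknC, ENNReal.ofReal_one, one_pow, inv_one, one_mul, hQ]
  have hQsub : I ×ˢ B ⊆ ((parabolicCylinderOpens 1 (0 : ℝ × EuclideanSpace ℝ (Fin 3)) :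
      Opens (ℝ × EuclideanSpace ℝ (Fin 3))) : Set (ℝ × EuclideanSpace ℝ (Fin 3))) := by
    rw [coe_parabolicCylinderOpens, hQ]
  have hum : AEStronglyMeasurable (uncurry u) (volume.restrict (I ×ˢ B)) :=
    (h.locallyIntegrableOn.mono_set hQsub).aestronglyMeasurable
  have hGm : AEStronglyMeasurable (uncurry G) (volume.restrict (I ×ˢ B)) :=
    (h.locallyIntegrableOn_grad.mono_set hQsub).aestronglyMeasurable
  have hprod : (volume.restrict (I ×ˢ B) : Measure (ℝ × EuclideanSpace ℝ (Fin 3))) =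
      (volume.restrict I).prod (volume.restrict B) := by
    rw [Measure.volume_eq_prod, Measure.prod_restrict]
  have hum' : AEStronglyMeasurable (uncurry u) ((volume.restrict I).prod (volume.restrict B)) := by
    rwa [← hprod]
  have hum3 : AEMeasurable (fun q : ℝ × EuclideanSpace ℝ (Fin 3) => ‖u q.1 q.2‖ₑ ^ (3 : ℕ))
      ((volume.restrict I).prod (volume.restrict B)) := hum'.enorm.pow_const 3
  have hGm2 : AEMeasurable (fun q : ℝ × EuclideanSpace ℝ (Fin 3) =>
      ENNReal.ofReal (frobeniusNormSq (G q.1 q.2))) ((volume.restrict I).prod (volume.restrict B)) := by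
    rw [← hprod]
    exact (continuous_frobeniusNormSq'.comp_aestronglyMeasurable hGm).aemeasurable.ennreal_ofReal
  -- measurability of the mean `t ↦ (|u|²)_{B₁}(t)` and of `H`
  have hsq : AEStronglyMeasurable (fun q : ℝ × EuclideanSpace ℝ (Fin 3) => ‖u q.1 q.2‖ ^ 2)
      ((volume.restrict I).prod (volume.restrict B)) := hum'.norm.pow 2
  have hmean : AEStronglyMeasurable (fun t => ⨍ y in B, ‖u t y‖ ^ 2) (volume.restrict I) := by
    have h1 : AEStronglyMeasurable (fun t => ∫ y in B, ‖u t y‖ ^ 2) (volume.restrict I) :=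
      hsq.integral_prod_right'
    have h2 : (fun t => ⨍ y in B, ‖u t y‖ ^ 2) = fun t => (volume.real B)⁻¹ • ∫ y in B, ‖u t y‖ ^ 2 := by
      funext t; rw [setAverage_eq]
    rw [h2]
    exact AEStronglyMeasurable.const_smul h1 ((volume.real B)⁻¹)
  have hHm : AEMeasurable H ((volume.restrict I).prod (volume.restrict B)) := by
    refine AEMeasurable.mul ?_ hum'.enorm
    exact (hsq.sub (hmean.comp_fst (ν := volume.restrict B))).enorm
  -- Tonelli
  have hEeq' : cknE 1 0 G = ∫⁻ t in I, e t := by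
    rw [hEeq, Measure.volume_eq_prod, setLIntegral_prod _ (by rwa [← Measure.prod_restrict])]
  have hCeq' : cknC 1 0 u = ∫⁻ t in I, c t := by
    rw [hCeq, Measure.volume_eq_prod, setLIntegral_prod _ (by rwa [← Measure.prod_restrict])]
  have hHeq : ∫⁻ z in I ×ˢ B, H z = ∫⁻ t in I, ∫⁻ x in B, H (t, x) := by
    rw [Measure.volume_eq_prod, setLIntegral_prod _ (by rwa [← Measure.prod_restrict])]
  have hem : AEMeasurable e (volume.restrict I) := hGm2.lintegral_prod_right'
  have hcm : AEMeasurable c (volume.restrict I) := hum3.lintegral_prod_right'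
  -- a.e. in time
  set A := cknAEss 1 0 u with hAdef
  set EE := cknE 1 0 G with hEdef
  have h1 : ∀ᵐ t ∂(volume.restrict I), a t ≤ A := by
    rw [hAeq]; exact ENNReal.ae_le_essSup a
  have h2 : ∀ᵐ t ∂(volume.restrict I), e t < ∞ := by
    refine ae_lt_top' hem ?_
    rw [← hEeq']; exact hE
  have h3 : ∀ᵐ t ∂(volume.restrict I), FunctionSpaces.HasWeakFDerivOn
      (⟨B, isOpen_ball⟩ : Opens (EuclideanSpace ℝ (Fin 3))) volume (u t) (G t) := by
    have := h.ae_hasWeakFDerivOn_ball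
    rwa [hQI] at this
  have hpt : ∀ᵐ t ∂(volume.restrict I), ∫⁻ x in B, H (t, x) ≤
      (C₄ : ℝ≥0∞) * A ^ (1 / 2 : ℝ) * (e t ^ (1 / 2 : ℝ) * c t ^ (1 / 3 : ℝ)) := by
    filter_upwards [h1, h2, h3] with t hat het hwt
    have hat' : a t ≠ ∞ := ne_top_of_le_ne_top hA hat
    have hutm : AEStronglyMeasurable (u t) (volume.restrict B) :=
      hwt.locallyIntegrableOn.aestronglyMeasurable
    have hGtm : AEStronglyMeasurable (G t) (volume.restrict B) :=
      hwt.locallyIntegrableOn_deriv.aestronglyMeasurable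
    have hL2 : eLpNorm (u t) 2 (volume.restrict B) = a t ^ (1 / 2 : ℝ) := by
      rw [eLpNorm_eq_lintegral_rpow_enorm_toReal two_ne_zero ENNReal.ofNat_ne_top,
        ENNReal.toReal_ofNat, ha]
      simp only [one_div]
      congr 1
      refine lintegral_congr fun x => ?_
      rw [show (2 : ℝ) = ((2 : ℕ) : ℝ) by norm_num, ENNReal.rpow_natCast]
    have hG2 : eLpNorm (G t) 2 (volume.restrict B) ≤ e t ^ (1 / 2 : ℝ) :=
      eLpNorm_two_le_lintegral_frobeniusNormSq_rpow _ _
    have hf2 : MemLp (u t) 2 (volume.restrict B) := by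
      refine ⟨hutm, ?_⟩
      rw [hL2]; exact ENNReal.rpow_lt_top_of_nonneg (by norm_num) hat'
    have hg2 : MemLp (G t) 2 (volume.restrict B) :=
      ⟨hGtm, hG2.trans_lt (ENNReal.rpow_lt_top_of_nonneg (by norm_num) het.ne)⟩
    have hsob : FunctionSpaces.MemSobolevDomain 1 2
        (⟨B, isOpen_ball⟩ : Opens (EuclideanSpace ℝ (Fin 3))) volume (u t) := by
      refine FunctionSpaces.memSobolevDomain_succ_iff.2 ⟨hf2, G t, hwt, fun v => ?_⟩
      rw [FunctionSpaces.memSobolevDomain_zero_iff]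
      exact (ContinuousLinearMap.apply ℝ (EuclideanSpace ℝ (Fin 3)) v).comp_memLp' hg2
    have key := hC₄ (u t) (G t) hsob hwt
    calc ∫⁻ x in B, H (t, x) ≤ C₄ * eLpNorm (u t) 2 (volume.restrict B) *
          eLpNorm (G t) 2 (volume.restrict B) * (∫⁻ x in B, ‖u t x‖ₑ ^ (3 : ℕ)) ^ (1 / 3 : ℝ) := key
      _ ≤ C₄ * A ^ (1 / 2 : ℝ) * e t ^ (1 / 2 : ℝ) * c t ^ (1 / 3 : ℝ) := by
          rw [hL2]
          gcongr
      _ = _ := by ring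
  -- integrate in time
  have hvolI : (volume.restrict I : Measure ℝ) univ ≤ 1 := by
    rw [Measure.restrict_apply_univ, hI, Real.volume_Ioo]; norm_num
  have hK : (C₄ : ℝ≥0∞) * A ^ (1 / 2 : ℝ) ≠ ∞ :=
    ENNReal.mul_ne_top ENNReal.coe_ne_top (ENNReal.rpow_ne_top_of_nonneg (by norm_num) hA)
  calc ∫⁻ z in I ×ˢ B, H z = ∫⁻ t in I, ∫⁻ x in B, H (t, x) := hHeq
    _ ≤ ∫⁻ t in I, (C₄ : ℝ≥0∞) * A ^ (1 / 2 : ℝ) * (e t ^ (1 / 2 : ℝ) * c t ^ (1 / 3 : ℝ)) :=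
        lintegral_mono_ae hpt
    _ = (C₄ : ℝ≥0∞) * A ^ (1 / 2 : ℝ) * ∫⁻ t in I, e t ^ (1 / 2 : ℝ) * c t ^ (1 / 3 : ℝ) := by
        rw [← lintegral_const_mul' _ _ hK]
    _ ≤ (C₄ : ℝ≥0∞) * A ^ (1 / 2 : ℝ) * ((∫⁻ t in I, e t) ^ (1 / 2 : ℝ) * (∫⁻ t in I, c t) ^ (1 / 3 : ℝ)) := by
        gcongr
        exact lintegral_sqrt_mul_cbrt_le _ hvolI hem hcm
    _ = C₄ * (A * EE) ^ (1 / 2 : ℝ) * cknC 1 0 u ^ (1 / 3 : ℝ) := by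
        rw [← hEeq', ← hCeq', ENNReal.mul_rpow_of_nonneg _ _ (by norm_num : (0 : ℝ) ≤ 1 / 2)]
        ring

/-- `x^e ≤ max 1 x` for `0 ≤ e ≤ 1` in `ℝ≥0∞`. [folklore] -/
theorem ENNReal.rpow_le_max_one_self {x : ℝ≥0∞} {e : ℝ} (he0 : 0 ≤ e) (he1 : e ≤ 1) :
    x ^ e ≤ max 1 x := by
  rcases le_total x 1 with h | h
  · exact (ENNReal.rpow_le_one h he0).trans (le_max_left _ _)
  · calc x ^ e ≤ x ^ (1 : ℝ) := ENNReal.rpow_le_rpow_of_exponent_le h he1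
      _ = x := ENNReal.rpow_one x
      _ ≤ max 1 x := le_max_right _ _

omit [InnerProductSpace ℝ E] in
/-- The four-term bound in `ℝ≥0∞` form. [folklore] -/
theorem ofReal_rhs_bound_eq {v w : E} {π a c θ : ℝ} (hc : 0 ≤ c) (hθ : 0 ≤ θ) :
    ENNReal.ofReal (c * θ ^ 2 * ‖v‖ ^ 2 + c * (θ ^ 2)⁻¹ * (|‖v‖ ^ 2 - a| * ‖v‖) +
        2 * c * (θ ^ 2)⁻¹ * (|π| * ‖v‖) + 2 * c * θ⁻¹ * (‖w‖ * ‖v‖)) =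
      ENNReal.ofReal (c * θ ^ 2) * ‖v‖ₑ ^ 2 +
        ENNReal.ofReal (c * (θ ^ 2)⁻¹) * (‖‖v‖ ^ 2 - a‖ₑ * ‖v‖ₑ) +
        ENNReal.ofReal (2 * c * (θ ^ 2)⁻¹) * (‖π‖ₑ * ‖v‖ₑ) +
        ENNReal.ofReal (2 * c * θ⁻¹) * (‖w‖ₑ * ‖v‖ₑ) := by
  have h1 : 0 ≤ c * θ ^ 2 * ‖v‖ ^ 2 := by positivity
  have h2 : 0 ≤ c * (θ ^ 2)⁻¹ * (|‖v‖ ^ 2 - a| * ‖v‖) := by positivity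
  have h3 : 0 ≤ 2 * c * (θ ^ 2)⁻¹ * (|π| * ‖v‖) := by positivity
  have h4 : 0 ≤ 2 * c * θ⁻¹ * (‖w‖ * ‖v‖) := by positivity
  have ev : ENNReal.ofReal ‖v‖ = ‖v‖ₑ := ofReal_norm v
  have ew : ENNReal.ofReal ‖w‖ = ‖w‖ₑ := ofReal_norm w
  have eπ : ENNReal.ofReal |π| = ‖π‖ₑ := (Real.enorm_eq_ofReal_abs π).symm
  have ea : ENNReal.ofReal |‖v‖ ^ 2 - a| = ‖‖v‖ ^ 2 - a‖ₑ := (Real.enorm_eq_ofReal_abs _).symm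
  have t1 : ENNReal.ofReal (c * θ ^ 2 * ‖v‖ ^ 2) = ENNReal.ofReal (c * θ ^ 2) * ‖v‖ₑ ^ 2 := by
    rw [ENNReal.ofReal_mul (by positivity : 0 ≤ c * θ ^ 2), ENNReal.ofReal_pow (norm_nonneg _), ev]
  have t2 : ENNReal.ofReal (c * (θ ^ 2)⁻¹ * (|‖v‖ ^ 2 - a| * ‖v‖)) =
      ENNReal.ofReal (c * (θ ^ 2)⁻¹) * (‖‖v‖ ^ 2 - a‖ₑ * ‖v‖ₑ) := by
    rw [ENNReal.ofReal_mul (by positivity : 0 ≤ c * (θ ^ 2)⁻¹), ENNReal.ofReal_mul (abs_nonneg _),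
      ea, ev]
  have t3 : ENNReal.ofReal (2 * c * (θ ^ 2)⁻¹ * (|π| * ‖v‖)) =
      ENNReal.ofReal (2 * c * (θ ^ 2)⁻¹) * (‖π‖ₑ * ‖v‖ₑ) := by
    rw [ENNReal.ofReal_mul (by positivity : 0 ≤ 2 * c * (θ ^ 2)⁻¹), ENNReal.ofReal_mul (abs_nonneg _),
      eπ, ev]
  have t4 : ENNReal.ofReal (2 * c * θ⁻¹ * (‖w‖ * ‖v‖)) =
      ENNReal.ofReal (2 * c * θ⁻¹) * (‖w‖ₑ * ‖v‖ₑ) := by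
    rw [ENNReal.ofReal_mul (by positivity : 0 ≤ 2 * c * θ⁻¹), ENNReal.ofReal_mul (norm_nonneg _),
      ew, ev]
  have s1 : 0 ≤ c * θ ^ 2 * ‖v‖ ^ 2 + c * (θ ^ 2)⁻¹ * (|‖v‖ ^ 2 - a| * ‖v‖) := add_nonneg h1 h2
  have s2 : 0 ≤ c * θ ^ 2 * ‖v‖ ^ 2 + c * (θ ^ 2)⁻¹ * (|‖v‖ ^ 2 - a| * ‖v‖) +
      2 * c * (θ ^ 2)⁻¹ * (|π| * ‖v‖) := add_nonneg s1 h3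
  rw [ENNReal.ofReal_add s2 h4, ENNReal.ofReal_add s1 h3, ENNReal.ofReal_add h1 h2, t1, t2, t3, t4]

/-- **Slice facts at unit scale.** For `u` with a weak spatial gradient on `Q₁(0)` and
`A(1) < ∞`: for a.e. `t ∈ (-1, 0)` the slice `u(t)` is measurable and square integrable on `B₁`
with `∫_{B₁} |u(t)|² ≤ A(1)`; the mean `(|u|²)_{B₁}(t)` is a measurable function of `(t, x)` on
`Q₁`, bounded a.e. by `A(1)/|B₁|`. [folklore] -/
theorem ae_slice_sq_facts {u : ℝ → EuclideanSpace ℝ (Fin 3) → EuclideanSpace ℝ (Fin 3)}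
    {G : ℝ → EuclideanSpace ℝ (Fin 3) → EuclideanSpace ℝ (Fin 3) →L[ℝ] EuclideanSpace ℝ (Fin 3)}
    (h : HasWeakSpatialGradientOn (parabolicCylinderOpens 1 0) u G) (hA : cknAEss 1 0 u ≠ ∞) :
    (∀ᵐ t ∂(volume : Measure ℝ), t ∈ Ioo (-1 : ℝ) 0 →
      AEStronglyMeasurable (u t) (volume.restrict (ball (0 : EuclideanSpace ℝ (Fin 3)) 1)) ∧
      IntegrableOn (fun x => ‖u t x‖ ^ 2) (ball (0 : EuclideanSpace ℝ (Fin 3)) 1) volume ∧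
      ∫⁻ x in ball (0 : EuclideanSpace ℝ (Fin 3)) 1, ‖u t x‖ₑ ^ 2 ≤ cknAEss 1 0 u ∧
      ∫ x in ball (0 : EuclideanSpace ℝ (Fin 3)) 1, ‖u t x‖ ^ 2 ≤ (cknAEss 1 0 u).toReal) ∧
    AEStronglyMeasurable (fun z : ℝ × EuclideanSpace ℝ (Fin 3) =>
        ⨍ y in ball (0 : EuclideanSpace ℝ (Fin 3)) 1, ‖u z.1 y‖ ^ 2)
      (volume.restrict (Ioo (-1 : ℝ) 0 ×ˢ ball (0 : EuclideanSpace ℝ (Fin 3)) 1)) ∧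
    (∀ᵐ z ∂(volume.restrict (Ioo (-1 : ℝ) 0 ×ˢ ball (0 : EuclideanSpace ℝ (Fin 3)) 1)),
      |⨍ y in ball (0 : EuclideanSpace ℝ (Fin 3)) 1, ‖u z.1 y‖ ^ 2| ≤
        (volume.real (ball (0 : EuclideanSpace ℝ (Fin 3)) 1))⁻¹ * (cknAEss 1 0 u).toReal) := by
  set B : Set (EuclideanSpace ℝ (Fin 3)) := ball 0 1 with hB
  set I : Set ℝ := Ioo (-1) 0 with hI
  set a : ℝ → ℝ≥0∞ := fun t => ∫⁻ x in B, ‖u t x‖ₑ ^ 2 with ha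
  set A := cknAEss 1 0 u with hAdef
  have hQ : parabolicCylinder 1 (0 : ℝ × EuclideanSpace ℝ (Fin 3)) = I ×ˢ B := by
    simp [parabolicCylinder, hI, hB]
  have hQI : Ioo ((0 : ℝ × EuclideanSpace ℝ (Fin 3)).1 - 1 ^ 2) (0 : ℝ × EuclideanSpace ℝ (Fin 3)).1 = I := by
    simp [hI]
  have hAeq : A = essSup a (volume.restrict I) := by
    simp only [hAdef, cknAEss, ENNReal.ofReal_one, inv_one, one_mul, hQI]
    rfl
  have hQsub : I ×ˢ B ⊆ ((parabolicCylinderOpens 1 (0 : ℝ × EuclideanSpace ℝ (Fin 3)) :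
      Opens (ℝ × EuclideanSpace ℝ (Fin 3))) : Set (ℝ × EuclideanSpace ℝ (Fin 3))) := by
    rw [coe_parabolicCylinderOpens, hQ]
  have hum : AEStronglyMeasurable (uncurry u) (volume.restrict (I ×ˢ B)) :=
    (h.locallyIntegrableOn.mono_set hQsub).aestronglyMeasurable
  have hprod : (volume.restrict (I ×ˢ B) : Measure (ℝ × EuclideanSpace ℝ (Fin 3))) =
      (volume.restrict I).prod (volume.restrict B) := by
    rw [Measure.volume_eq_prod, Measure.prod_restrict]
  have hum' : AEStronglyMeasurable (uncurry u) ((volume.restrict I).prod (volume.restrict B)) := by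
    rwa [← hprod]
  have hsq : AEStronglyMeasurable (fun q : ℝ × EuclideanSpace ℝ (Fin 3) => ‖u q.1 q.2‖ ^ 2)
      ((volume.restrict I).prod (volume.restrict B)) := hum'.norm.pow 2
  have hmean : AEStronglyMeasurable (fun t => ⨍ y in B, ‖u t y‖ ^ 2) (volume.restrict I) := by
    have h1 : AEStronglyMeasurable (fun t => ∫ y in B, ‖u t y‖ ^ 2) (volume.restrict I) :=
      hsq.integral_prod_right'
    have h2 : (fun t => ⨍ y in B, ‖u t y‖ ^ 2) = fun t => (volume.real B)⁻¹ • ∫ y in B, ‖u t y‖ ^ 2 := by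
      funext t; rw [setAverage_eq]
    rw [h2]
    exact AEStronglyMeasurable.const_smul h1 ((volume.real B)⁻¹)
  -- a.e. in time
  have h1 : ∀ᵐ t ∂(volume.restrict I), a t ≤ A := by
    rw [hAeq]; exact ENNReal.ae_le_essSup a
  have h3 : ∀ᵐ t ∂(volume.restrict I), FunctionSpaces.HasWeakFDerivOn
      (⟨B, isOpen_ball⟩ : Opens (EuclideanSpace ℝ (Fin 3))) volume (u t) (G t) := by
    have := h.ae_hasWeakFDerivOn_ball
    rwa [hQI] at this
  have hslice : ∀ᵐ t ∂(volume.restrict I),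
      AEStronglyMeasurable (u t) (volume.restrict B) ∧ IntegrableOn (fun x => ‖u t x‖ ^ 2) B volume ∧
        a t ≤ A ∧ ∫ x in B, ‖u t x‖ ^ 2 ≤ A.toReal := by
    filter_upwards [h1, h3] with t hat hwt
    have hutm : AEStronglyMeasurable (u t) (volume.restrict B) :=
      hwt.locallyIntegrableOn.aestronglyMeasurable
    have hlin : ∫⁻ x in B, ‖‖u t x‖ ^ 2‖ₑ = a t := by
      refine lintegral_congr fun x => ?_
      rw [Real.enorm_eq_ofReal (sq_nonneg _), ENNReal.ofReal_pow (norm_nonneg _), ofReal_norm]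
    have hint : IntegrableOn (fun x => ‖u t x‖ ^ 2) B volume := by
      refine ⟨hutm.norm.pow 2, ?_⟩
      rw [hasFiniteIntegral_iff_enorm, hlin]
      exact lt_of_le_of_lt hat (lt_top_iff_ne_top.2 hA)
    refine ⟨hutm, hint, hat, ?_⟩
    have heq : ∫ x in B, ‖u t x‖ ^ 2 = (a t).toReal := by
      rw [integral_eq_lintegral_of_nonneg_ae (Eventually.of_forall fun x => sq_nonneg _)
        (hutm.norm.pow 2)]
      congr 1
      refine lintegral_congr fun x => ?_
      rw [ENNReal.ofReal_pow (norm_nonneg _), ofReal_norm]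
    rw [heq]
    exact ENNReal.toReal_mono hA hat
  refine ⟨(ae_restrict_iff' measurableSet_Ioo).1 hslice, ?_, ?_⟩
  · rw [hprod]; exact hmean.comp_fst
  · -- transport the bound on the mean to the product
    have hb : ∀ᵐ t ∂(volume.restrict I), |⨍ y in B, ‖u t y‖ ^ 2| ≤ (volume.real B)⁻¹ * A.toReal := by
      filter_upwards [hslice] with t ht
      rw [setAverage_eq, smul_eq_mul, abs_of_nonneg (mul_nonneg (inv_nonneg.2 measureReal_nonneg)
        (integral_nonneg fun x => sq_nonneg _))]
      exact mul_le_mul_of_nonneg_left ht.2.2.2 (inv_nonneg.2 measureReal_nonneg)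
    rw [hprod]
    exact (Measure.quasiMeasurePreserving_fst (μ := volume.restrict I) (ν := volume.restrict B)).ae hb

set_option maxHeartbeats 1600000 in
-- the assembled measure-theoretic argument is long; the heartbeat bump only covers this proof
/-- **The local-energy decay estimate at unit scale, raw form** (Robinson–Rodrigo–Sadowski 2016,
pp. 241–242 before Young's inequality, with the force term of Caffarelli–Kohn–Nirenberg 1982,
(2.5)): with Scheffer's constant `c_T` and absolute `c₁, C₄, c₂`,
`A(θ) + E(θ) ≤ 2c_T (c_T θ² c₁ C^{2/3} + c_T C₄ θ⁻² (AE)^{1/2} C^{1/3} + 2c_T θ⁻² D^{2/3} C^{1/3}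
  + 2c_T c₂ θ⁻¹ F_q^{1/q} C^{1/3})`, all quantities at `r = 1`, `z = 0`, assumed finite.
[cite: RobinsonRodrigoSadowski2016, proof of Thm. 16.1 pp. 241–242] -/
theorem localEnergy_master :
    ∃ cT c1 C4 c2 : ℝ, 0 < cT ∧ 0 ≤ c1 ∧ 0 ≤ C4 ∧ 1 ≤ c2 ∧
      ∀ (Q : Opens (ℝ × EuclideanSpace ℝ (Fin 3))) (q : ℝ)
        (f u : ℝ → EuclideanSpace ℝ (Fin 3) → EuclideanSpace ℝ (Fin 3))
        (p : ℝ → EuclideanSpace ℝ (Fin 3) → ℝ)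
        (G : ℝ → EuclideanSpace ℝ (Fin 3) → EuclideanSpace ℝ (Fin 3) →L[ℝ] EuclideanSpace ℝ (Fin 3)),
        IsSuitableWeakSolutionOn Q 1 f u p → 5 / 2 < q →
        MemLp (uncurry f) (ENNReal.ofReal q)
          (volume.restrict (Q : Set (ℝ × EuclideanSpace ℝ (Fin 3)))) →
        HasWeakSpatialGradientOn Q u G →
        closure (parabolicCylinder 1 (0 : ℝ × EuclideanSpace ℝ (Fin 3))) ⊆
          (Q : Set (ℝ × EuclideanSpace ℝ (Fin 3))) →
        cknAEss 1 0 u ≠ ∞ → cknE 1 0 G ≠ ∞ → cknC 1 0 u ≠ ∞ → cknD 1 0 p ≠ ∞ → cknF q 1 0 f ≠ ∞ →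
        ∀ θ : ℝ, 0 < θ → θ ≤ 1 / 2 →
          cknAEss θ 0 u + cknE θ 0 G ≤ ENNReal.ofReal (2 * cT) *
            (ENNReal.ofReal (cT * θ ^ 2 * c1) * cknC 1 0 u ^ (2 / 3 : ℝ) +
              ENNReal.ofReal (cT * C4 * (θ ^ 2)⁻¹) * (cknAEss 1 0 u * cknE 1 0 G) ^ (1 / 2 : ℝ) *
                cknC 1 0 u ^ (1 / 3 : ℝ) +
              ENNReal.ofReal (2 * cT * (θ ^ 2)⁻¹) * cknD 1 0 p ^ (2 / 3 : ℝ) * cknC 1 0 u ^ (1 / 3 : ℝ) +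
              ENNReal.ofReal (2 * cT * c2 * θ⁻¹) * cknF q 1 0 f ^ (1 / q) *
                cknC 1 0 u ^ (1 / 3 : ℝ)) := by
  obtain ⟨cT, hcT, hspec⟩ := Scheffer.testFn_spec (E := EuclideanSpace ℝ (Fin 3)) one_pos
  obtain ⟨C4, hC4⟩ := exists_lintegral_meanZero_cubic_le
  set S : Set (ℝ × EuclideanSpace ℝ (Fin 3)) := Ioo (-1 : ℝ) 0 ×ˢ ball (0 : EuclideanSpace ℝ (Fin 3)) 1
    with hS
  have hSmeas : MeasurableSet S := measurableSet_Ioo.prod measurableSet_ball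
  have hSvol : volume S < ∞ := by
    have hsub : S ⊆ Icc (-1 : ℝ) 0 ×ˢ closedBall (0 : EuclideanSpace ℝ (Fin 3)) 1 :=
      prod_mono Ioo_subset_Icc_self ball_subset_closedBall
    exact lt_of_le_of_lt (measure_mono hsub)
      ((isCompact_Icc.prod (isCompact_closedBall _ _)).measure_lt_top)
  set c1 : ℝ := ((volume S) ^ (1 / 3 : ℝ)).toReal with hc1
  set c2 : ℝ := (max 1 (volume S)).toReal with hc2
  have hc1eq : ENNReal.ofReal c1 = (volume S) ^ (1 / 3 : ℝ) :=
    ENNReal.ofReal_toReal (ENNReal.rpow_ne_top_of_nonneg (by norm_num) hSvol.ne)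
  have hmaxne : max 1 (volume S) ≠ ∞ := by simp [hSvol.ne]
  have hc2eq : ENNReal.ofReal c2 = max 1 (volume S) := ENNReal.ofReal_toReal hmaxne
  have hc2one : 1 ≤ c2 := by
    have : (1 : ℝ≥0∞).toReal ≤ (max 1 (volume S)).toReal := ENNReal.toReal_mono hmaxne (le_max_left _ _)
    simpa using this
  refine ⟨cT, c1, C4, c2, hcT, ENNReal.toReal_nonneg, C4.2, hc2one, ?_⟩
  intro Q q f u p G hsol hq hf hG hcl hA hE hC hD hF θ hθ hθ2
  have hθ1 : θ < 1 := by linarith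
  -- ### Step 1: restriction to `Q₁ = (-1, 0) × B₁`
  have hcylS : parabolicCylinder 1 (0 : ℝ × EuclideanSpace ℝ (Fin 3)) = S := by
    simp [parabolicCylinder, hS]
  have hQS : ((parabolicCylinderOpens 1 (0 : ℝ × EuclideanSpace ℝ (Fin 3)) :
      Opens (ℝ × EuclideanSpace ℝ (Fin 3))) : Set (ℝ × EuclideanSpace ℝ (Fin 3))) = S := by
    rw [coe_parabolicCylinderOpens, hcylS]
  have hSQ : S ⊆ (Q : Set (ℝ × EuclideanSpace ℝ (Fin 3))) := by
    rw [← hcylS]; exact subset_closure.trans hcl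
  have hle : parabolicCylinderOpens 1 (0 : ℝ × EuclideanSpace ℝ (Fin 3)) ≤ Q := by
    intro z hz
    exact hSQ (hQS ▸ hz)
  have h₁ : IsSuitableWeakSolutionOn (parabolicCylinderOpens 1 (0 : ℝ × EuclideanSpace ℝ (Fin 3)))
      1 f u p := hsol.of_le hle
  have hG₁ : HasWeakSpatialGradientOn (parabolicCylinderOpens 1 (0 : ℝ × EuclideanSpace ℝ (Fin 3)))
      u G := hG.mono hle
  -- measurability on `S`
  have hum : AEStronglyMeasurable (uncurry u) (volume.restrict S) := by
    have := hG₁.locallyIntegrableOn.aestronglyMeasurable; rwa [hQS] at this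
  have hGm : AEStronglyMeasurable (uncurry G) (volume.restrict S) := by
    have := hG₁.locallyIntegrableOn_grad.aestronglyMeasurable; rwa [hQS] at this
  have hpm : AEStronglyMeasurable (uncurry p) (volume.restrict S) := by
    have := h₁.distributional.2.2.1.aestronglyMeasurable; rwa [hQS] at this
  have hfS : MemLp (uncurry f) (ENNReal.ofReal q) (volume.restrict S) :=
    hf.mono_measure (Measure.restrict_mono_set _ hSQ)
  have hfm : AEStronglyMeasurable (uncurry f) (volume.restrict S) := hfS.1
  -- the quantities at unit scale
  have hCeq : cknC 1 0 u = ∫⁻ z in S, ‖u z.1 z.2‖ₑ ^ (3 : ℕ) := by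
    simp only [cknC, ENNReal.ofReal_one, one_pow, inv_one, one_mul, hcylS]
  have hDeq : cknD 1 0 p = ∫⁻ z in S, ‖p z.1 z.2‖ₑ ^ (3 / 2 : ℝ) := by
    simp only [cknD, ENNReal.ofReal_one, one_pow, inv_one, one_mul, hcylS]
  have hEeq : cknE 1 0 G = ∫⁻ z in S, ENNReal.ofReal (frobeniusNormSq (G z.1 z.2)) := by
    simp only [cknE, ENNReal.ofReal_one, inv_one, one_mul, hcylS]
  have hFeq : cknF q 1 0 f = ∫⁻ z in S, ‖f z.1 z.2‖ₑ ^ q := by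
    simp only [cknF, Real.one_rpow, ENNReal.ofReal_one, one_mul, hcylS]
  have hfinS : IsFiniteMeasure (volume.restrict S) := ⟨by rw [Measure.restrict_apply_univ]; exact hSvol⟩
  have hu3S : ∫⁻ z in S, ‖u z.1 z.2‖ₑ ^ (3 : ℕ) < ∞ := by rw [← hCeq]; exact lt_top_iff_ne_top.2 hC
  -- ### Step 2: Scheffer's test function with inner radius `θ`
  set ψ : ℝ → EuclideanSpace ℝ (Fin 3) → ℝ := Scheffer.testFn 1 θ 1 0 0 with hψdef
  obtain ⟨htest, hψ0, hψC, hψsupp, hψlow, hψgrad, hψheat⟩ :=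
    hspec 0 (0 : EuclideanSpace ℝ (Fin 3)) θ 1 hθ (by linarith)
  have hfin : Module.finrank ℝ (EuclideanSpace ℝ (Fin 3)) = 3 := finrank_euclideanSpace_fin
  have hheat : ∀ s (y : EuclideanSpace ℝ (Fin 3)), s < 0 →
      |timeDeriv ψ s y + 1 * Δ (ψ s) y| ≤ cT * θ * θ ^ 2 := by
    intro s y hs
    have := hψheat s y (by nlinarith [sq_nonneg θ])
    rw [hfin, one_pow, div_one] at this
    calc _ ≤ cT * θ ^ 3 := this
      _ = cT * θ * θ ^ 2 := by ring
  have hgradb : ∀ s (y : EuclideanSpace ℝ (Fin 3)), ‖gradient (ψ s) y‖ ≤ cT * θ * (θ ^ 2)⁻¹ := by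
    intro s y
    have e : ‖gradient (ψ s) y‖ = ‖fderiv ℝ (ψ s) y‖ := by
      rw [gradient, LinearIsometryEquiv.norm_map]
    rw [e]
    calc ‖fderiv ℝ (ψ s) y‖ ≤ cT / θ := hψgrad s y
      _ = cT * θ * (θ ^ 2)⁻¹ := by field_simp
  have hψC' : ∀ s (y : EuclideanSpace ℝ (Fin 3)), ψ s y ≤ cT * θ * θ⁻¹ := fun s y =>
    (hψC s y).trans (le_of_eq (by field_simp))
  have hψsupp' : ∀ s (y : EuclideanSpace ℝ (Fin 3)), ψ s y ≠ 0 → |s| < 1 / 2 ∧ ‖y‖ < 5 / 8 := by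
    intro s y h
    have := hψsupp s y h
    simpa using this
  have hlow : ∀ s (y : EuclideanSpace ℝ (Fin 3)), -θ ^ 2 < s → s < θ ^ 2 → ‖y‖ < θ → cT⁻¹ ≤ ψ s y := by
    intro s y hs1 hs2 hy
    refine hψlow s y ?_
    rw [mem_parabolicCylinderCentered]
    refine ⟨⟨by simpa using hs1, by simpa using hs2⟩, by simpa using hy⟩
  -- continuity and support of the coefficient fields
  have hψ' : IsSpaceTimeTestOn (⊤ : Opens (ℝ × EuclideanSpace ℝ (Fin 3))) ψ := htest.mono le_top
  have hcψ : Continuous fun z : ℝ × EuclideanSpace ℝ (Fin 3) => ψ z.1 z.2 := htest.contDiff.continuous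
  have hcT' : Continuous fun z : ℝ × EuclideanSpace ℝ (Fin 3) => timeDeriv ψ z.1 z.2 :=
    hψ'.timeDeriv_top.contDiff.continuous
  have hcL : Continuous fun z : ℝ × EuclideanSpace ℝ (Fin 3) => Δ (ψ z.1) z.2 :=
    hψ'.laplacian_top.contDiff.continuous
  obtain ⟨hcg, -, hg0⟩ := htest.continuous_gradient_field
  set K : Set (ℝ × EuclideanSpace ℝ (Fin 3)) := tsupport (uncurry ψ) with hK
  have hg0' : ∀ z ∉ K, gradient (ψ z.1) z.2 = 0 := hg0
  have hψK : ∀ z ∉ K, ψ z.1 z.2 = 0 := fun z hz =>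
    show uncurry ψ z = 0 from image_eq_zero_of_notMem_tsupport hz
  have hTK : ∀ z ∉ K, timeDeriv ψ z.1 z.2 = 0 := fun z hz =>
    IsSpaceTimeTestOn.timeDeriv_eq_zero_of_notMem hz
  have hLK : ∀ z ∉ K, Δ (ψ z.1) z.2 = 0 := fun z hz =>
    laplacian_eq_zero_of_notMem_tsupport (notMem_tsupport_slice hz)
  have hKS : ∀ z ∈ K, z.1 < 0 → z ∈ S := by
    intro z hz hz0
    have hK' : K ⊆ Icc (-(1 / 2 : ℝ)) (1 / 2) ×ˢ closedBall (0 : EuclideanSpace ℝ (Fin 3)) (5 / 8) := by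
      refine closure_minimal (fun w hw => ?_) (isClosed_Icc.prod isClosed_closedBall)
      have h := hψsupp' w.1 w.2 hw
      refine ⟨⟨by linarith [(abs_lt.1 h.1).1], by linarith [(abs_lt.1 h.1).2]⟩, ?_⟩
      rw [mem_closedBall, dist_zero_right]; exact h.2.le
    obtain ⟨⟨hw1, -⟩, hw2⟩ := hK' hz
    rw [mem_closedBall, dist_zero_right] at hw2
    refine ⟨⟨by linarith, hz0⟩, ?_⟩
    rw [mem_ball, dist_zero_right]; linarith
  have hnotK : ∀ z : ℝ × EuclideanSpace ℝ (Fin 3), z.1 < 0 → z ∉ S → z ∉ K :=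
    fun z hz0 hzS hzK => hzS (hKS z hzK hz0)
  -- ### Step 3: the sliced local energy inequality and the divergence-free slices
  have hfuS : IntegrableOn (fun z : ℝ × EuclideanSpace ℝ (Fin 3) => ⟪f z.1 z.2, u z.1 z.2⟫) S volume :=
    integrable_inner_of_memLp_of_lintegral_cube (volume.restrict S) (by linarith) hfS hum hu3S
  have hu3I : IntegrableOn (fun z : ℝ × EuclideanSpace ℝ (Fin 3) => ‖u z.1 z.2‖ ^ 3) S volume := by
    refine ⟨hum.norm.pow 3, ?_⟩
    rw [hasFiniteIntegral_iff_enorm]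
    refine lt_of_le_of_lt (lintegral_mono fun z => ?_) hu3S
    rw [Real.enorm_eq_ofReal (by positivity), ENNReal.ofReal_pow (norm_nonneg _), ofReal_norm]
  have hLEI := ae_localEnergy_slice_cutoff h₁ hG₁ (by rw [hcylS]; exact hu3I.locallyIntegrableOn)
    (by rw [hcylS]; exact hfuS.locallyIntegrableOn) htest.contDiff hψ0
    (fun s y h => by linarith [(abs_lt.1 (hψsupp' s y h).1).1]) (fun s y h => (hψsupp' s y h).2)
  have hdivae := ae_integral_inner_gradient_timeCut_eq_zero (u := u)
    (by rw [hcylS, ← hQS]; exact hG₁.locallyIntegrableOn)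
    (fun ϑ hϑ => by
      have := h₁.distributional.2.2.2.1 ϑ hϑ
      rwa [coe_parabolicCylinderOpens] at this)
    htest.contDiff (fun s y h => by linarith [(abs_lt.1 (hψsupp' s y h).1).1])
    (fun s y h => (hψsupp' s y h).2)
  -- ### Step 4: slice facts and the mean `(|u|²)_{B₁}(t)`
  obtain ⟨hslice, hmeanm, hmeanb⟩ := ae_slice_sq_facts hG₁ hA
  set α : ℝ → ℝ := fun t => ⨍ y in ball (0 : EuclideanSpace ℝ (Fin 3)) 1, ‖u t y‖ ^ 2 with hα
  set A := cknAEss 1 0 u with hAdef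
  -- ### Step 5: the dominating function on `S` and its integral
  set bound : ℝ × EuclideanSpace ℝ (Fin 3) → ℝ := fun z =>
    cT * θ * θ ^ 2 * ‖u z.1 z.2‖ ^ 2 +
      cT * θ * (θ ^ 2)⁻¹ * (|‖u z.1 z.2‖ ^ 2 - α z.1| * ‖u z.1 z.2‖) +
      2 * (cT * θ) * (θ ^ 2)⁻¹ * (|p z.1 z.2| * ‖u z.1 z.2‖) +
      2 * (cT * θ) * θ⁻¹ * (‖f z.1 z.2‖ * ‖u z.1 z.2‖) with hbound
  have hbound0 : ∀ z, 0 ≤ bound z := fun z => by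
    simp only [hbound]
    have := hcT.le
    positivity
  set L : ℝ≥0∞ := ∫⁻ z in S, ENNReal.ofReal (bound z) with hL
  -- the four integrals
  set I1 : ℝ≥0∞ := ∫⁻ z in S, ‖u z.1 z.2‖ₑ ^ 2 with hI1
  set I2 : ℝ≥0∞ := ∫⁻ z in S, ‖‖u z.1 z.2‖ ^ 2 - α z.1‖ₑ * ‖u z.1 z.2‖ₑ with hI2
  set I3 : ℝ≥0∞ := ∫⁻ z in S, ‖p z.1 z.2‖ₑ * ‖u z.1 z.2‖ₑ with hI3
  set I4 : ℝ≥0∞ := ∫⁻ z in S, ‖f z.1 z.2‖ₑ * ‖u z.1 z.2‖ₑ with hI4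
  have hI1m : AEMeasurable (fun z : ℝ × EuclideanSpace ℝ (Fin 3) => ‖u z.1 z.2‖ₑ ^ 2)
      (volume.restrict S) := hum.enorm.pow_const 2
  have hI2m : AEMeasurable (fun z : ℝ × EuclideanSpace ℝ (Fin 3) =>
      ‖‖u z.1 z.2‖ ^ 2 - α z.1‖ₑ * ‖u z.1 z.2‖ₑ) (volume.restrict S) :=
    ((hum.norm.pow 2).sub hmeanm).enorm.mul hum.enorm
  have hI3m : AEMeasurable (fun z : ℝ × EuclideanSpace ℝ (Fin 3) => ‖p z.1 z.2‖ₑ * ‖u z.1 z.2‖ₑ)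
      (volume.restrict S) := hpm.enorm.mul hum.enorm
  have hI4m : AEMeasurable (fun z : ℝ × EuclideanSpace ℝ (Fin 3) => ‖f z.1 z.2‖ₑ * ‖u z.1 z.2‖ₑ)
      (volume.restrict S) := hfm.enorm.mul hum.enorm
  have hLeq : L = ENNReal.ofReal (cT * θ * θ ^ 2) * I1 + ENNReal.ofReal (cT * θ * (θ ^ 2)⁻¹) * I2 +
      ENNReal.ofReal (2 * (cT * θ) * (θ ^ 2)⁻¹) * I3 + ENNReal.ofReal (2 * (cT * θ) * θ⁻¹) * I4 := by
    have hc : 0 ≤ cT * θ := by positivity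
    have m1 : AEMeasurable (fun z : ℝ × EuclideanSpace ℝ (Fin 3) =>
        ENNReal.ofReal (cT * θ * θ ^ 2) * ‖u z.1 z.2‖ₑ ^ 2) (volume.restrict S) := hI1m.const_mul _
    have m2 : AEMeasurable (fun z : ℝ × EuclideanSpace ℝ (Fin 3) =>
        ENNReal.ofReal (cT * θ * (θ ^ 2)⁻¹) * (‖‖u z.1 z.2‖ ^ 2 - α z.1‖ₑ * ‖u z.1 z.2‖ₑ))
        (volume.restrict S) := hI2m.const_mul _
    have m3 : AEMeasurable (fun z : ℝ × EuclideanSpace ℝ (Fin 3) =>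
        ENNReal.ofReal (2 * (cT * θ) * (θ ^ 2)⁻¹) * (‖p z.1 z.2‖ₑ * ‖u z.1 z.2‖ₑ))
        (volume.restrict S) := hI3m.const_mul _
    calc L = ∫⁻ z in S, (ENNReal.ofReal (cT * θ * θ ^ 2) * ‖u z.1 z.2‖ₑ ^ 2 +
          ENNReal.ofReal (cT * θ * (θ ^ 2)⁻¹) * (‖‖u z.1 z.2‖ ^ 2 - α z.1‖ₑ * ‖u z.1 z.2‖ₑ) +
          ENNReal.ofReal (2 * (cT * θ) * (θ ^ 2)⁻¹) * (‖p z.1 z.2‖ₑ * ‖u z.1 z.2‖ₑ) +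
          ENNReal.ofReal (2 * (cT * θ) * θ⁻¹) * (‖f z.1 z.2‖ₑ * ‖u z.1 z.2‖ₑ)) :=
          lintegral_congr fun z => ofReal_rhs_bound_eq hc hθ.le
      _ = (∫⁻ z in S, ENNReal.ofReal (cT * θ * θ ^ 2) * ‖u z.1 z.2‖ₑ ^ 2) +
          (∫⁻ z in S, ENNReal.ofReal (cT * θ * (θ ^ 2)⁻¹) * (‖‖u z.1 z.2‖ ^ 2 - α z.1‖ₑ * ‖u z.1 z.2‖ₑ)) +
          (∫⁻ z in S, ENNReal.ofReal (2 * (cT * θ) * (θ ^ 2)⁻¹) * (‖p z.1 z.2‖ₑ * ‖u z.1 z.2‖ₑ)) +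
          (∫⁻ z in S, ENNReal.ofReal (2 * (cT * θ) * θ⁻¹) * (‖f z.1 z.2‖ₑ * ‖u z.1 z.2‖ₑ)) := by
          have m12 : AEMeasurable (fun z : ℝ × EuclideanSpace ℝ (Fin 3) =>
              ENNReal.ofReal (cT * θ * θ ^ 2) * ‖u z.1 z.2‖ₑ ^ 2 +
              ENNReal.ofReal (cT * θ * (θ ^ 2)⁻¹) * (‖‖u z.1 z.2‖ ^ 2 - α z.1‖ₑ * ‖u z.1 z.2‖ₑ))
              (volume.restrict S) := m1.add m2
          have m123 : AEMeasurable (fun z : ℝ × EuclideanSpace ℝ (Fin 3) =>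
              ENNReal.ofReal (cT * θ * θ ^ 2) * ‖u z.1 z.2‖ₑ ^ 2 +
              ENNReal.ofReal (cT * θ * (θ ^ 2)⁻¹) * (‖‖u z.1 z.2‖ ^ 2 - α z.1‖ₑ * ‖u z.1 z.2‖ₑ) +
              ENNReal.ofReal (2 * (cT * θ) * (θ ^ 2)⁻¹) * (‖p z.1 z.2‖ₑ * ‖u z.1 z.2‖ₑ))
              (volume.restrict S) := m12.add m3
          rw [lintegral_add_left' m123, lintegral_add_left' m12, lintegral_add_left' m1]
      _ = _ := by
          rw [hI1, hI2, hI3, hI4, lintegral_const_mul' _ _ ENNReal.ofReal_ne_top,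
            lintegral_const_mul' _ _ ENNReal.ofReal_ne_top, lintegral_const_mul' _ _ ENNReal.ofReal_ne_top,
            lintegral_const_mul' _ _ ENNReal.ofReal_ne_top]
  -- the four bounds
  have hB1 : I1 ≤ cknC 1 0 u ^ (2 / 3 : ℝ) * ENNReal.ofReal c1 := by
    rw [hc1eq, hCeq, hI1]
    have := lintegral_sq_le_cube (volume.restrict S) hum.enorm
    rwa [Measure.restrict_apply_univ] at this
  have hB2 : I2 ≤ C4 * (A * cknE 1 0 G) ^ (1 / 2 : ℝ) * cknC 1 0 u ^ (1 / 3 : ℝ) := hC4 u G hG₁ hA hE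
  have hB3 : I3 ≤ cknD 1 0 p ^ (2 / 3 : ℝ) * cknC 1 0 u ^ (1 / 3 : ℝ) := by
    rw [hDeq, hCeq, hI3]
    exact lintegral_mul_le_threeHalves_three (volume.restrict S) hpm.enorm hum.enorm
  have hB4 : I4 ≤ ENNReal.ofReal c2 * cknF q 1 0 f ^ (1 / q) * cknC 1 0 u ^ (1 / 3 : ℝ) := by
    have hq1 : 1 < q := by linarith
    set q' : ℝ := q.conjExponent with hq'
    have hqq' : q.HolderConjugate q' := Real.HolderConjugate.conjExponent hq1
    have hq'0 : 0 < q' := hqq'.symm.pos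
    have hq'3 : q' ≤ 3 := by
      have e1 : q' = q / (q - 1) := rfl
      rw [e1, div_le_iff₀ (by linarith)]
      linarith
    have hH := ENNReal.lintegral_mul_le_Lp_mul_Lq (volume.restrict S) hqq' hfm.enorm hum.enorm
    simp only [Pi.mul_apply] at hH
    -- `(∫ |u|^{q'})^{1/q'} = ‖u‖_{L^{q'}(S)} ≤ ‖u‖_{L³(S)} |S|^{1/q' - 1/3}`
    have hq'e : (ENNReal.ofReal q').toReal = q' := ENNReal.toReal_ofReal hq'0.le
    have e1 : (∫⁻ z in S, ‖uncurry u z‖ₑ ^ q') ^ (1 / q') =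
        eLpNorm (uncurry u) (ENNReal.ofReal q') (volume.restrict S) := by
      rw [eLpNorm_eq_lintegral_rpow_enorm_toReal (by simp [hq'0]) ENNReal.ofReal_ne_top, hq'e]
    have e3 : eLpNorm (uncurry u) 3 (volume.restrict S) = cknC 1 0 u ^ (1 / 3 : ℝ) := by
      rw [eLpNorm_eq_lintegral_rpow_enorm_toReal (by norm_num) (by norm_num), hCeq]
      simp only [ENNReal.toReal_ofNat, one_div]
      congr 1
      refine lintegral_congr fun z => ?_
      rw [show (3 : ℝ) = ((3 : ℕ) : ℝ) by norm_num, ENNReal.rpow_natCast]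
      rfl
    have hcmp : eLpNorm (uncurry u) (ENNReal.ofReal q') (volume.restrict S) ≤
        eLpNorm (uncurry u) 3 (volume.restrict S) * (volume.restrict S) univ ^
          (1 / (ENNReal.ofReal q').toReal - 1 / (3 : ℝ≥0∞).toReal) :=
      eLpNorm_le_eLpNorm_mul_rpow_measure_univ
        (ENNReal.ofReal_le_of_le_toReal (by simpa using hq'3)) hum
    rw [hq'e, ENNReal.toReal_ofNat, Measure.restrict_apply_univ, e3] at hcmp
    have hexp0 : 0 ≤ 1 / q' - 1 / 3 := by
      rw [sub_nonneg]; exact one_div_le_one_div_of_le hq'0 hq'3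
    have hexp1 : 1 / q' - 1 / 3 ≤ 1 := by
      have : 0 < 1 / q' := by positivity
      have : 1 / q' ≤ 1 := by rw [div_le_one hq'0]; exact hqq'.symm.lt.le
      linarith
    have hvolb : volume S ^ (1 / q' - 1 / 3) ≤ ENNReal.ofReal c2 := by
      rw [hc2eq]; exact ENNReal.rpow_le_max_one_self hexp0 hexp1
    have hFq : (∫⁻ z in S, ‖uncurry f z‖ₑ ^ q) ^ (1 / q) = cknF q 1 0 f ^ (1 / q) := by
      rw [hFeq]; rfl
    calc I4 = ∫⁻ z in S, ‖uncurry f z‖ₑ * ‖uncurry u z‖ₑ := rfl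
      _ ≤ (∫⁻ z in S, ‖uncurry f z‖ₑ ^ q) ^ (1 / q) * (∫⁻ z in S, ‖uncurry u z‖ₑ ^ q') ^ (1 / q') := hH
      _ ≤ cknF q 1 0 f ^ (1 / q) * (cknC 1 0 u ^ (1 / 3 : ℝ) * ENNReal.ofReal c2) := by
          rw [hFq, e1]
          gcongr
          exact hcmp.trans (by gcongr)
      _ = _ := by ring
  have hLtop : L ≠ ∞ := by
    rw [hLeq]
    have hCt : cknC 1 0 u ^ (1 / 3 : ℝ) ≠ ∞ := ENNReal.rpow_ne_top_of_nonneg (by norm_num) hC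
    refine ENNReal.add_ne_top.2 ⟨ENNReal.add_ne_top.2 ⟨ENNReal.add_ne_top.2 ⟨?_, ?_⟩, ?_⟩, ?_⟩
    · refine ENNReal.mul_ne_top ENNReal.ofReal_ne_top (ne_top_of_le_ne_top ?_ hB1)
      exact ENNReal.mul_ne_top (ENNReal.rpow_ne_top_of_nonneg (by norm_num) hC) ENNReal.ofReal_ne_top
    · refine ENNReal.mul_ne_top ENNReal.ofReal_ne_top (ne_top_of_le_ne_top ?_ hB2)
      exact ENNReal.mul_ne_top (ENNReal.mul_ne_top ENNReal.coe_ne_top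
        (ENNReal.rpow_ne_top_of_nonneg (by norm_num) (ENNReal.mul_ne_top hA hE))) hCt
    · refine ENNReal.mul_ne_top ENNReal.ofReal_ne_top (ne_top_of_le_ne_top ?_ hB3)
      exact ENNReal.mul_ne_top (ENNReal.rpow_ne_top_of_nonneg (by norm_num) hD) hCt
    · refine ENNReal.mul_ne_top ENNReal.ofReal_ne_top (ne_top_of_le_ne_top ?_ hB4)
      exact ENNReal.mul_ne_top (ENNReal.mul_ne_top ENNReal.ofReal_ne_top
        (ENNReal.rpow_ne_top_of_nonneg (by positivity) hF)) hCt
  -- ### Step 6: the right-hand side of the sliced inequality is at most `L.toReal`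
  set d : ℝ × EuclideanSpace ℝ (Fin 3) → ℝ := fun z => timeDeriv ψ z.1 z.2 + 1 * Δ (ψ z.1) z.2 with hd
  set g : ℝ × EuclideanSpace ℝ (Fin 3) → EuclideanSpace ℝ (Fin 3) := fun z => gradient (ψ z.1) z.2
    with hg
  set R' : ℝ × EuclideanSpace ℝ (Fin 3) → ℝ := fun z =>
    ‖u z.1 z.2‖ ^ 2 * d z + (‖u z.1 z.2‖ ^ 2 - α z.1 + 2 * p z.1 z.2) * ⟪u z.1 z.2, g z⟫ +
      2 * ⟪f z.1 z.2, u z.1 z.2⟫ * ψ z.1 z.2 with hR'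
  set M : ℝ × EuclideanSpace ℝ (Fin 3) → ℝ := fun z => α z.1 * ⟪u z.1 z.2, g z⟫ with hM
  have hdc : Continuous d := hcT'.add (continuous_const.mul hcL)
  -- `|R'| ≤ bound` in negative time, `R' = 0 = M` off `S` in negative time
  have hR'le : ∀ z : ℝ × EuclideanSpace ℝ (Fin 3), z.1 < 0 → ‖R' z‖ ≤ bound z := by
    intro z hz
    rw [Real.norm_eq_abs, hR', hbound]
    exact abs_rhs_le (hheat z.1 z.2 hz) (hgradb z.1 z.2) (hψ0 z.1 z.2) (hψC' z.1 z.2)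
  have hR'zero : ∀ z : ℝ × EuclideanSpace ℝ (Fin 3), z.1 < 0 → z ∉ S → R' z = 0 := by
    intro z hz hzS
    have hzK := hnotK z hz hzS
    simp only [hR', hd, hg, hTK z hzK, hLK z hzK, hg0' z hzK, hψK z hzK, inner_zero_right, mul_zero,
      add_zero]
  have hMzero : ∀ z : ℝ × EuclideanSpace ℝ (Fin 3), z.1 < 0 → z ∉ S → M z = 0 := by
    intro z hz hzS
    simp only [hM, hg, hg0' z (hnotK z hz hzS), inner_zero_right, mul_zero]
  -- measurability and integrability on `S`
  have hu2m : AEStronglyMeasurable (fun z : ℝ × EuclideanSpace ℝ (Fin 3) => ‖u z.1 z.2‖ ^ 2)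
      (volume.restrict S) := hum.norm.pow 2
  have hgm : AEStronglyMeasurable g (volume.restrict S) := hcg.aestronglyMeasurable
  have hψm : AEStronglyMeasurable (fun z : ℝ × EuclideanSpace ℝ (Fin 3) => ψ z.1 z.2)
      (volume.restrict S) := hcψ.aestronglyMeasurable
  have hR'm : AEStronglyMeasurable R' (volume.restrict S) :=
    ((hu2m.mul hdc.aestronglyMeasurable).add
      (((hu2m.sub hmeanm).add (hpm.const_mul 2)).mul (hum.inner hgm))).add
      (((hfm.inner hum).const_mul 2).mul hψm)
  have hMm : AEStronglyMeasurable M (volume.restrict S) := hmeanm.mul (hum.inner hgm)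
  have hboundI : Integrable bound (volume.restrict S) := by
    refine ⟨(((hu2m.const_mul _).add (((hu2m.sub hmeanm).norm.mul hum.norm).const_mul _)).add
      ((hpm.norm.mul hum.norm).const_mul _)).add ((hfm.norm.mul hum.norm).const_mul _), ?_⟩
    rw [hasFiniteIntegral_iff_enorm]
    calc ∫⁻ z in S, ‖bound z‖ₑ = L := lintegral_congr fun z => Real.enorm_eq_ofReal (hbound0 z)
      _ < ∞ := lt_top_iff_ne_top.2 hLtop
  have hR'I : IntegrableOn R' S volume :=
    hboundI.mono' hR'm ((ae_restrict_mem hSmeas).mono fun z hz => hR'le z hz.1.2)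
  have huI : Integrable (fun z : ℝ × EuclideanSpace ℝ (Fin 3) => ‖u z.1 z.2‖) (volume.restrict S) := by
    refine ((integrable_const (1 : ℝ)).add hu3I).mono' hum.norm (ae_of_all _ fun z => ?_)
    rw [norm_norm]
    have := rpow_le_one_add_pow_three (norm_nonneg (u z.1 z.2)) zero_le_one (by norm_num : (1 : ℝ) ≤ 3)
    rwa [Real.rpow_one] at this
  have hMI : IntegrableOn M S volume := by
    refine Integrable.mono' (huI.const_mul ((volume.real (ball (0 : EuclideanSpace ℝ (Fin 3)) 1))⁻¹ *
      A.toReal * (cT * θ * (θ ^ 2)⁻¹))) hMm ?_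
    filter_upwards [hmeanb] with z hz
    calc ‖M z‖ = |α z.1| * |⟪u z.1 z.2, g z⟫| := by rw [Real.norm_eq_abs, hM, abs_mul]
      _ ≤ ((volume.real (ball (0 : EuclideanSpace ℝ (Fin 3)) 1))⁻¹ * A.toReal) *
          (‖u z.1 z.2‖ * (cT * θ * (θ ^ 2)⁻¹)) :=
          mul_le_mul hz ((abs_real_inner_le_norm _ _).trans
            (mul_le_mul_of_nonneg_left (hgradb _ _) (norm_nonneg _))) (abs_nonneg _) (by positivity)
      _ = _ := by ring
  have hTs : ∀ s : ℝ, MeasurableSet {z : ℝ × EuclideanSpace ℝ (Fin 3) | z.1 < s} := fun s =>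
    measurableSet_lt measurable_fst measurable_const
  have hR'Is : ∀ s, s < 0 → IntegrableOn R' {z | z.1 < s} volume := fun s hs =>
    hR'I.of_forall_sdiff_eq_zero (hTs s) fun z hz => hR'zero z (lt_trans hz.1 hs) hz.2
  have hMIs : ∀ s, s < 0 → IntegrableOn M {z | z.1 < s} volume := fun s hs =>
    hMI.of_forall_sdiff_eq_zero (hTs s) fun z hz => hMzero z (lt_trans hz.1 hs) hz.2
  -- the mean-value term integrates to zero (the slices are divergence free)
  have hMint0 : ∀ s, s < 0 → ∫ z in {z : ℝ × EuclideanSpace ℝ (Fin 3) | z.1 < s}, M z = 0 := by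
    intro s hs
    have hMIs' := hMIs s hs
    have hset : {z : ℝ × EuclideanSpace ℝ (Fin 3) | z.1 < s} = Iio s ×ˢ (univ : Set (EuclideanSpace ℝ (Fin 3))) := by
      ext z; simp
    have hμ : (volume.restrict {z : ℝ × EuclideanSpace ℝ (Fin 3) | z.1 < s}) =
        (volume.restrict (Iio s)).prod (volume : Measure (EuclideanSpace ℝ (Fin 3))) := by
      rw [hset, Measure.volume_eq_prod, Measure.restrict_prod_eq_prod_univ]
    rw [IntegrableOn, hμ] at hMIs'
    rw [hμ, integral_prod _ hMIs']
    refine integral_eq_zero_of_ae ?_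
    filter_upwards [ae_restrict_mem measurableSet_Iio, ae_restrict_of_ae hdivae] with t ht hdiv
    have ht0 : t < 0 := lt_trans ht hs
    simp only [hM, hg, Pi.zero_apply]
    rw [integral_const_mul, hdiv ht0, mul_zero]
  -- consequences of the sliced inequality at good times
  have hgood : ∀ᵐ s ∂(volume : Measure ℝ), s < 0 →
      (∫ x, ‖u s x‖ ^ 2 * ψ s x) ≤ L.toReal ∧
      2 * ∫ z in {z : ℝ × EuclideanSpace ℝ (Fin 3) | z.1 < s},
        frobeniusNormSq (G z.1 z.2) * ψ z.1 z.2 ≤ L.toReal := by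
    filter_upwards [hLEI] with s hs hs0
    have key := hs hs0
    have hsplit : ∫ z in {z : ℝ × EuclideanSpace ℝ (Fin 3) | z.1 < s},
        (‖u z.1 z.2‖ ^ 2 * (timeDeriv ψ z.1 z.2 + 1 * Δ (ψ z.1) z.2) +
          (‖u z.1 z.2‖ ^ 2 + 2 * p z.1 z.2) * ⟪u z.1 z.2, gradient (ψ z.1) z.2⟫ +
          2 * ⟪f z.1 z.2, u z.1 z.2⟫ * ψ z.1 z.2) =
        (∫ z in {z : ℝ × EuclideanSpace ℝ (Fin 3) | z.1 < s}, R' z) +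
          ∫ z in {z : ℝ × EuclideanSpace ℝ (Fin 3) | z.1 < s}, M z := by
      rw [← integral_add (hR'Is s hs0) (hMIs s hs0)]
      refine integral_congr_ae (ae_of_all _ fun z => ?_)
      simp only [hR', hM, hd, hg]
      ring
    have hRle : ∫ z in {z : ℝ × EuclideanSpace ℝ (Fin 3) | z.1 < s}, R' z ≤ L.toReal := by
      have h1 : ∫⁻ z in {z : ℝ × EuclideanSpace ℝ (Fin 3) | z.1 < s}, ENNReal.ofReal ‖R' z‖ ≤ L := by
        calc ∫⁻ z in {z : ℝ × EuclideanSpace ℝ (Fin 3) | z.1 < s}, ENNReal.ofReal ‖R' z‖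
            ≤ ∫⁻ z in {z : ℝ × EuclideanSpace ℝ (Fin 3) | z.1 < s},
                S.indicator (fun z => ENNReal.ofReal (bound z)) z := by
              refine setLIntegral_mono' (hTs s) fun z hz => ?_
              have hz0 : z.1 < 0 := lt_trans hz hs0
              by_cases hzS : z ∈ S
              · rw [indicator_of_mem hzS]
                exact ENNReal.ofReal_le_ofReal (hR'le z hz0)
              · rw [indicator_of_notMem hzS, hR'zero z hz0 hzS, norm_zero, ENNReal.ofReal_zero]
          _ ≤ ∫⁻ z, S.indicator (fun z => ENNReal.ofReal (bound z)) z := setLIntegral_le_lintegral _ _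
          _ = L := by rw [lintegral_indicator hSmeas]
      calc ∫ z in {z : ℝ × EuclideanSpace ℝ (Fin 3) | z.1 < s}, R' z
          ≤ ‖∫ z in {z : ℝ × EuclideanSpace ℝ (Fin 3) | z.1 < s}, R' z‖ := by
            rw [Real.norm_eq_abs]; exact le_abs_self _
        _ ≤ (∫⁻ z in {z : ℝ × EuclideanSpace ℝ (Fin 3) | z.1 < s}, ENNReal.ofReal ‖R' z‖).toReal :=
            norm_integral_le_lintegral_norm _
        _ ≤ L.toReal := ENNReal.toReal_mono hLtop h1
    have hU0 : 0 ≤ ∫ x, ‖u s x‖ ^ 2 * ψ s x :=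
      integral_nonneg fun x => mul_nonneg (sq_nonneg _) (hψ0 _ _)
    have hV0 : 0 ≤ ∫ z in {z : ℝ × EuclideanSpace ℝ (Fin 3) | z.1 < s},
        frobeniusNormSq (G z.1 z.2) * ψ z.1 z.2 :=
      integral_nonneg fun z => mul_nonneg (frobeniusNormSq_nonneg _) (hψ0 _ _)
    rw [hsplit, hMint0 s hs0, add_zero] at key
    constructor <;> nlinarith [key, hRle, hU0, hV0]
  -- ### Step 7: lower bounds — `A(θ)` and `E(θ)`
  have h1le : ∀ s (y : EuclideanSpace ℝ (Fin 3)), -θ ^ 2 < s → s < θ ^ 2 → ‖y‖ < θ → 1 ≤ cT * ψ s y := by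
    intro s y hs1 hs2 hy
    have := mul_le_mul_of_nonneg_left (hlow s y hs1 hs2 hy) hcT.le
    rwa [mul_inv_cancel₀ hcT.ne'] at this
  have hAθ : cknAEss θ 0 u ≤ (ENNReal.ofReal θ)⁻¹ * (ENNReal.ofReal cT * ENNReal.ofReal L.toReal) := by
    have hIθ : Ioo ((0 : ℝ × EuclideanSpace ℝ (Fin 3)).1 - θ ^ 2) (0 : ℝ × EuclideanSpace ℝ (Fin 3)).1 =
        Ioo (-θ ^ 2) 0 := by simp
    simp only [cknAEss, hIθ, Prod.snd_zero]
    refine essSup_le_of_ae_le _ ((ae_restrict_iff' measurableSet_Ioo).2 ?_)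
    filter_upwards [hgood, hslice] with t hgt hsl ht
    have ht0 : t < 0 := ht.2
    have htI : t ∈ Ioo (-1 : ℝ) 0 := ⟨by nlinarith [ht.1], ht.2⟩
    obtain ⟨-, hint, -, -⟩ := hsl htI
    obtain ⟨hU, -⟩ := hgt ht0
    gcongr
    have hWint : Integrable (fun x => ‖u t x‖ ^ 2 * ψ t x) volume := by
      have hWB : IntegrableOn (fun x => ‖u t x‖ ^ 2 * ψ t x) (ball 0 1) volume :=
        Integrable.mul_bdd hint (hcψ.comp (Continuous.prodMk_right t)).aestronglyMeasurable
          (ae_of_all _ fun x => by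
            rw [Real.norm_eq_abs, abs_of_nonneg (hψ0 t x)]; exact hψC t x)
      refine hWB.integrable_of_forall_notMem_eq_zero fun x hx => ?_
      have : ψ t x = 0 := by
        by_contra h
        exact hx (by rw [mem_ball, dist_zero_right]; linarith [(hψsupp' t x h).2])
      simp [this]
    calc ∫⁻ x in ball 0 θ, ‖u t x‖ₑ ^ 2
        ≤ ∫⁻ x in ball 0 θ, ENNReal.ofReal cT * ENNReal.ofReal (‖u t x‖ ^ 2 * ψ t x) := by
          refine setLIntegral_mono' measurableSet_ball fun x hx => ?_
          rw [mem_ball, dist_zero_right] at hx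
          have hlo := h1le t x ht.1 (by nlinarith [sq_nonneg θ]) hx
          rw [← ENNReal.ofReal_mul hcT.le, ← ofReal_norm, ← ENNReal.ofReal_pow (norm_nonneg _)]
          refine ENNReal.ofReal_le_ofReal ?_
          nlinarith [sq_nonneg ‖u t x‖]
      _ ≤ ENNReal.ofReal cT * ∫⁻ x, ENNReal.ofReal (‖u t x‖ ^ 2 * ψ t x) := by
          rw [lintegral_const_mul' _ _ ENNReal.ofReal_ne_top]
          exact mul_le_mul' le_rfl (setLIntegral_le_lintegral _ _)
      _ = ENNReal.ofReal cT * ENNReal.ofReal (∫ x, ‖u t x‖ ^ 2 * ψ t x) := by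
          rw [ofReal_integral_eq_lintegral_ofReal hWint
            (ae_of_all _ fun x => mul_nonneg (sq_nonneg _) (hψ0 t x))]
      _ ≤ ENNReal.ofReal cT * ENNReal.ofReal L.toReal := by gcongr
  have hEθ : cknE θ 0 G ≤ (ENNReal.ofReal θ)⁻¹ * (ENNReal.ofReal cT * ENNReal.ofReal (L.toReal / 2)) := by
    have hQθ : parabolicCylinder θ (0 : ℝ × EuclideanSpace ℝ (Fin 3)) =
        Ioo (-θ ^ 2) 0 ×ˢ ball (0 : EuclideanSpace ℝ (Fin 3)) θ := by
      simp [parabolicCylinder]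
    simp only [cknE]
    gcongr
    refine setLIntegral_le_of_ae_neg_time (fun z hz => ?_) ?_
    · rw [hQθ] at hz; exact hz.1.2
    filter_upwards [hgood] with s hgs hs0
    obtain ⟨-, hV⟩ := hgs hs0
    have hFS : IntegrableOn (fun z : ℝ × EuclideanSpace ℝ (Fin 3) =>
        frobeniusNormSq (G z.1 z.2) * ψ z.1 z.2) S volume := by
      have hfr : IntegrableOn (fun z : ℝ × EuclideanSpace ℝ (Fin 3) => frobeniusNormSq (G z.1 z.2)) S
          volume := by
        refine ⟨continuous_frobeniusNormSq'.comp_aestronglyMeasurable hGm, ?_⟩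
        rw [hasFiniteIntegral_iff_enorm]
        calc ∫⁻ z in S, ‖frobeniusNormSq (G z.1 z.2)‖ₑ = cknE 1 0 G := by
              rw [hEeq]; exact lintegral_congr fun z => Real.enorm_eq_ofReal (frobeniusNormSq_nonneg _)
          _ < ∞ := lt_top_iff_ne_top.2 hE
      exact hfr.mul_bdd hψm (ae_of_all _ fun z => by
        rw [Real.norm_eq_abs, abs_of_nonneg (hψ0 _ _)]; exact hψC _ _)
    have hFs : IntegrableOn (fun z : ℝ × EuclideanSpace ℝ (Fin 3) =>
        frobeniusNormSq (G z.1 z.2) * ψ z.1 z.2) {z : ℝ × EuclideanSpace ℝ (Fin 3) | z.1 < s} volume :=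
      hFS.of_forall_sdiff_eq_zero (hTs s) fun z hz => by
        rw [hψK z (hnotK z (lt_trans hz.1 hs0) hz.2), mul_zero]
    calc ∫⁻ z in parabolicCylinder θ 0 ∩ {z : ℝ × EuclideanSpace ℝ (Fin 3) | z.1 < s},
          ENNReal.ofReal (frobeniusNormSq (G z.1 z.2))
        ≤ ∫⁻ z in parabolicCylinder θ 0 ∩ {z : ℝ × EuclideanSpace ℝ (Fin 3) | z.1 < s},
            ENNReal.ofReal cT * ENNReal.ofReal (frobeniusNormSq (G z.1 z.2) * ψ z.1 z.2) := by
          refine setLIntegral_mono' ((isOpen_parabolicCylinder θ 0).measurableSet.inter (hTs s))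
            fun z hz => ?_
          have hz1 := hz.1
          rw [hQθ] at hz1
          obtain ⟨⟨hz11, hz12⟩, hz2⟩ := hz1
          rw [mem_ball, dist_zero_right] at hz2
          have hlo := h1le z.1 z.2 hz11 (by nlinarith [sq_nonneg θ]) hz2
          rw [← ENNReal.ofReal_mul hcT.le]
          refine ENNReal.ofReal_le_ofReal ?_
          nlinarith [frobeniusNormSq_nonneg (G z.1 z.2)]
      _ ≤ ENNReal.ofReal cT * ∫⁻ z in {z : ℝ × EuclideanSpace ℝ (Fin 3) | z.1 < s},
            ENNReal.ofReal (frobeniusNormSq (G z.1 z.2) * ψ z.1 z.2) := by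
          rw [lintegral_const_mul' _ _ ENNReal.ofReal_ne_top]
          exact mul_le_mul' le_rfl (lintegral_mono_set inter_subset_right)
      _ = ENNReal.ofReal cT * ENNReal.ofReal (∫ z in {z : ℝ × EuclideanSpace ℝ (Fin 3) | z.1 < s},
            frobeniusNormSq (G z.1 z.2) * ψ z.1 z.2) := by
          rw [ofReal_integral_eq_lintegral_ofReal hFs
            (ae_of_all _ fun z => mul_nonneg (frobeniusNormSq_nonneg _) (hψ0 _ _))]
      _ ≤ ENNReal.ofReal cT * ENNReal.ofReal (L.toReal / 2) := by
          gcongr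
          linarith
  -- ### Step 8: conclusion
  have hLr : ENNReal.ofReal L.toReal ≤ L := ENNReal.ofReal_toReal_le
  have hLr2 : ENNReal.ofReal (L.toReal / 2) ≤ L :=
    (ENNReal.ofReal_le_ofReal (by linarith [ENNReal.toReal_nonneg (a := L)])).trans hLr
  have hθinv : (ENNReal.ofReal θ)⁻¹ = ENNReal.ofReal θ⁻¹ := (ENNReal.ofReal_inv_of_pos hθ).symm
  have hfinal : ENNReal.ofReal θ⁻¹ * L ≤
      ENNReal.ofReal (cT * θ ^ 2 * c1) * cknC 1 0 u ^ (2 / 3 : ℝ) +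
        ENNReal.ofReal (cT * C4 * (θ ^ 2)⁻¹) * (cknAEss 1 0 u * cknE 1 0 G) ^ (1 / 2 : ℝ) *
          cknC 1 0 u ^ (1 / 3 : ℝ) +
        ENNReal.ofReal (2 * cT * (θ ^ 2)⁻¹) * cknD 1 0 p ^ (2 / 3 : ℝ) * cknC 1 0 u ^ (1 / 3 : ℝ) +
        ENNReal.ofReal (2 * cT * c2 * θ⁻¹) * cknF q 1 0 f ^ (1 / q) * cknC 1 0 u ^ (1 / 3 : ℝ) := by
    rw [hLeq, mul_add, mul_add, mul_add]
    have hθi : 0 ≤ θ⁻¹ := inv_nonneg.2 hθ.le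
    refine add_le_add (add_le_add (add_le_add ?_ ?_) ?_) ?_
    · calc ENNReal.ofReal θ⁻¹ * (ENNReal.ofReal (cT * θ * θ ^ 2) * I1)
          = ENNReal.ofReal (cT * θ ^ 2) * I1 := by
            rw [← mul_assoc, ← ENNReal.ofReal_mul hθi,
              show θ⁻¹ * (cT * θ * θ ^ 2) = cT * θ ^ 2 by field_simp]
        _ ≤ ENNReal.ofReal (cT * θ ^ 2) * (cknC 1 0 u ^ (2 / 3 : ℝ) * ENNReal.ofReal c1) := by gcongr
        _ = _ := by rw [ENNReal.ofReal_mul (by positivity : 0 ≤ cT * θ ^ 2)]; ring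
    · calc ENNReal.ofReal θ⁻¹ * (ENNReal.ofReal (cT * θ * (θ ^ 2)⁻¹) * I2)
          = ENNReal.ofReal (cT * (θ ^ 2)⁻¹) * I2 := by
            rw [← mul_assoc, ← ENNReal.ofReal_mul hθi,
              show θ⁻¹ * (cT * θ * (θ ^ 2)⁻¹) = cT * (θ ^ 2)⁻¹ by field_simp]
        _ ≤ ENNReal.ofReal (cT * (θ ^ 2)⁻¹) * (C4 * (A * cknE 1 0 G) ^ (1 / 2 : ℝ) *
              cknC 1 0 u ^ (1 / 3 : ℝ)) := by gcongr
        _ = _ := by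
            rw [show cT * C4 * (θ ^ 2)⁻¹ = cT * (θ ^ 2)⁻¹ * C4 by ring,
              ENNReal.ofReal_mul (by positivity : 0 ≤ cT * (θ ^ 2)⁻¹), ENNReal.ofReal_coe_nnreal]
            ring
    · calc ENNReal.ofReal θ⁻¹ * (ENNReal.ofReal (2 * (cT * θ) * (θ ^ 2)⁻¹) * I3)
          = ENNReal.ofReal (2 * cT * (θ ^ 2)⁻¹) * I3 := by
            rw [← mul_assoc, ← ENNReal.ofReal_mul hθi,
              show θ⁻¹ * (2 * (cT * θ) * (θ ^ 2)⁻¹) = 2 * cT * (θ ^ 2)⁻¹ by field_simp]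
        _ ≤ ENNReal.ofReal (2 * cT * (θ ^ 2)⁻¹) * (cknD 1 0 p ^ (2 / 3 : ℝ) * cknC 1 0 u ^ (1 / 3 : ℝ)) := by
            gcongr
        _ = _ := by ring
    · calc ENNReal.ofReal θ⁻¹ * (ENNReal.ofReal (2 * (cT * θ) * θ⁻¹) * I4)
          = ENNReal.ofReal (2 * cT * θ⁻¹) * I4 := by
            rw [← mul_assoc, ← ENNReal.ofReal_mul hθi,
              show θ⁻¹ * (2 * (cT * θ) * θ⁻¹) = 2 * cT * θ⁻¹ by field_simp]
        _ ≤ ENNReal.ofReal (2 * cT * θ⁻¹) * (ENNReal.ofReal c2 * cknF q 1 0 f ^ (1 / q) *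
              cknC 1 0 u ^ (1 / 3 : ℝ)) := by gcongr
        _ = _ := by
            rw [show 2 * cT * c2 * θ⁻¹ = 2 * cT * θ⁻¹ * c2 by ring,
              ENNReal.ofReal_mul (by positivity : 0 ≤ 2 * cT * θ⁻¹)]
            ring
  calc cknAEss θ 0 u + cknE θ 0 G
      ≤ (ENNReal.ofReal θ)⁻¹ * (ENNReal.ofReal cT * ENNReal.ofReal L.toReal) +
          (ENNReal.ofReal θ)⁻¹ * (ENNReal.ofReal cT * ENNReal.ofReal (L.toReal / 2)) := add_le_add hAθ hEθ
    _ ≤ (ENNReal.ofReal θ)⁻¹ * (ENNReal.ofReal cT * L) + (ENNReal.ofReal θ)⁻¹ * (ENNReal.ofReal cT * L) := by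
        gcongr
    _ = ENNReal.ofReal (2 * cT) * (ENNReal.ofReal θ⁻¹ * L) := by
        rw [hθinv, ENNReal.ofReal_mul (by norm_num : (0 : ℝ) ≤ 2), ENNReal.ofReal_ofNat]
        ring
    _ ≤ _ := by gcongr

end UnitScale

/-! ### The discharge of `localEnergyEstimate` -/

section Final

/-- **The local-energy decay estimate at unit scale** (Robinson–Rodrigo–Sadowski 2016, (16.13)
with `r = 1`, plus the force term): absolute `κ₁, …, κ₄` with
`A(θ) + E(θ) ≤ κ₁θ²(A(1) + E(1)) + κ₂θ⁻⁶A(1)E(1) + κ₃θ⁻⁶D(1)^{4/3} + κ₄θ⁻⁴F_q(1)^{2/q}` for every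
suitable weak solution around `closure Q₁(0)`, `θ ∈ (0, 1/2]` (from `localEnergy_master`,
the interpolation inequality `exists_cknC_le_rpow` and Young's inequality `localEnergy_algebra`;
if one of `A(1), E(1), D(1), F_q(1)` is infinite the right-hand side is `∞`).
[cite: RobinsonRodrigoSadowski2016, proof of Thm. 16.1 (16.13)] -/
theorem localEnergyEstimate_unitScale :
    ∃ κ₁ κ₂ κ₃ κ₄ : ℝ≥0, ∀ (Q : Opens (ℝ × EuclideanSpace ℝ (Fin 3))) (q : ℝ)
      (f u : ℝ → EuclideanSpace ℝ (Fin 3) → EuclideanSpace ℝ (Fin 3))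
      (p : ℝ → EuclideanSpace ℝ (Fin 3) → ℝ)
      (G : ℝ → EuclideanSpace ℝ (Fin 3) → EuclideanSpace ℝ (Fin 3) →L[ℝ] EuclideanSpace ℝ (Fin 3)),
      IsSuitableWeakSolutionOn Q 1 f u p → 5 / 2 < q →
      MemLp (uncurry f) (ENNReal.ofReal q)
        (volume.restrict (Q : Set (ℝ × EuclideanSpace ℝ (Fin 3)))) →
      HasWeakSpatialGradientOn Q u G →
      closure (parabolicCylinder 1 (0 : ℝ × EuclideanSpace ℝ (Fin 3))) ⊆
        (Q : Set (ℝ × EuclideanSpace ℝ (Fin 3))) →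
      ∀ θ : ℝ, 0 < θ → θ ≤ 1 / 2 →
        cknAEss θ 0 u + cknE θ 0 G ≤
          κ₁ * ENNReal.ofReal (θ ^ 2) * (cknAEss 1 0 u + cknE 1 0 G) +
          κ₂ * ENNReal.ofReal ((θ ^ 6)⁻¹) * (cknAEss 1 0 u * cknE 1 0 G) +
          κ₃ * ENNReal.ofReal ((θ ^ 6)⁻¹) * cknD 1 0 p ^ (4 / 3 : ℝ) +
          κ₄ * ENNReal.ofReal ((θ ^ 4)⁻¹) * cknF q 1 0 f ^ (2 / q) := by
  obtain ⟨cT, c1, C4, c2, hcT, hc1, hC4, hc2, hM⟩ := localEnergy_master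
  obtain ⟨C0, hC0⟩ := exists_cknC_le_rpow
  set C0' : ℝ≥0 := max C0 1 with hC0'
  set κ₁ : ℝ≥0 := Real.toNNReal (2 * cT * (cT * c1 + 3 / 2)) * C0' ^ (2 / 3 : ℝ) with hκ₁
  set κ₂ : ℝ≥0 := Real.toNNReal (cT * (cT * C4) ^ 2) with hκ₂
  set κ₃ : ℝ≥0 := Real.toNNReal (cT * (2 * cT) ^ 2) with hκ₃
  set κ₄ : ℝ≥0 := Real.toNNReal (cT * (2 * cT * c2) ^ 2) with hκ₄
  have hC0'pos : 0 < C0' := lt_of_lt_of_le zero_lt_one (le_max_right _ _)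
  have hκ₁ne : (κ₁ : ℝ≥0∞) ≠ 0 := by
    rw [ENNReal.coe_ne_zero, hκ₁]
    refine mul_ne_zero ?_ (NNReal.rpow_pos hC0'pos).ne'
    rw [Ne, Real.toNNReal_eq_zero, not_le]
    nlinarith
  have hκ₃ne : (κ₃ : ℝ≥0∞) ≠ 0 := by
    rw [ENNReal.coe_ne_zero, hκ₃, Ne, Real.toNNReal_eq_zero, not_le]; positivity
  have hκ₄ne : (κ₄ : ℝ≥0∞) ≠ 0 := by
    rw [ENNReal.coe_ne_zero, hκ₄, Ne, Real.toNNReal_eq_zero, not_le]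
    have : 0 < c2 := by linarith
    positivity
  refine ⟨κ₁, κ₂, κ₃, κ₄, fun Q q f u p G hsol hq hf hG hcl θ hθ hθ2 => ?_⟩
  have hθ2ne : ENNReal.ofReal (θ ^ 2) ≠ 0 := (ENNReal.ofReal_pos.2 (by positivity)).ne'
  have hθ6ne : ENNReal.ofReal ((θ ^ 6)⁻¹) ≠ 0 := (ENNReal.ofReal_pos.2 (by positivity)).ne'
  have hθ4ne : ENNReal.ofReal ((θ ^ 4)⁻¹) ≠ 0 := (ENNReal.ofReal_pos.2 (by positivity)).ne'
  -- the infinite cases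
  by_cases hA : cknAEss 1 0 u = ∞
  · have hT : (κ₁ : ℝ≥0∞) * ENNReal.ofReal (θ ^ 2) * (cknAEss 1 0 u + cknE 1 0 G) = ∞ := by
      rw [hA, top_add, ENNReal.mul_top (mul_ne_zero hκ₁ne hθ2ne)]
    calc _ ≤ (⊤ : ℝ≥0∞) := le_top
      _ = _ := by rw [hT, top_add, top_add, top_add]
  by_cases hE : cknE 1 0 G = ∞
  · have hT : (κ₁ : ℝ≥0∞) * ENNReal.ofReal (θ ^ 2) * (cknAEss 1 0 u + cknE 1 0 G) = ∞ := by
      rw [hE, add_top, ENNReal.mul_top (mul_ne_zero hκ₁ne hθ2ne)]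
    calc _ ≤ (⊤ : ℝ≥0∞) := le_top
      _ = _ := by rw [hT, top_add, top_add, top_add]
  by_cases hD : cknD 1 0 p = ∞
  · have hT : (κ₃ : ℝ≥0∞) * ENNReal.ofReal ((θ ^ 6)⁻¹) * cknD 1 0 p ^ (4 / 3 : ℝ) = ∞ := by
      rw [hD, ENNReal.top_rpow_of_pos (by norm_num), ENNReal.mul_top (mul_ne_zero hκ₃ne hθ6ne)]
    calc _ ≤ (⊤ : ℝ≥0∞) := le_top
      _ = _ := by rw [hT, add_top, top_add]
  by_cases hF : cknF q 1 0 f = ∞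
  · have hT : (κ₄ : ℝ≥0∞) * ENNReal.ofReal ((θ ^ 4)⁻¹) * cknF q 1 0 f ^ (2 / q) = ∞ := by
      rw [hF, ENNReal.top_rpow_of_pos (by positivity), ENNReal.mul_top (mul_ne_zero hκ₄ne hθ4ne)]
    calc _ ≤ (⊤ : ℝ≥0∞) := le_top
      _ = _ := by rw [hT, add_top]
  -- the finite case
  have hle : parabolicCylinderOpens 1 (0 : ℝ × EuclideanSpace ℝ (Fin 3)) ≤ Q := by
    intro z hz
    have hz' : z ∈ parabolicCylinder 1 (0 : ℝ × EuclideanSpace ℝ (Fin 3)) := by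
      rwa [← coe_parabolicCylinderOpens]
    exact hcl (subset_closure hz')
  have hG₁ : HasWeakSpatialGradientOn (parabolicCylinderOpens 1 (0 : ℝ × EuclideanSpace ℝ (Fin 3)))
      u G := hG.mono hle
  have hCle : cknC 1 0 u ≤ C0 * (cknAEss 1 0 u + cknE 1 0 G) ^ (3 / 2 : ℝ) :=
    hC0 u G 0 1 one_pos hG₁ hA hE
  have hCle' : cknC 1 0 u ≤ C0' * (cknAEss 1 0 u + cknE 1 0 G) ^ (3 / 2 : ℝ) :=
    hCle.trans (by gcongr; exact le_max_left _ _)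
  have hC : cknC 1 0 u ≠ ∞ :=
    ne_top_of_le_ne_top (ENNReal.mul_ne_top ENNReal.coe_ne_top
      (ENNReal.rpow_ne_top_of_nonneg (by norm_num) (ENNReal.add_ne_top.2 ⟨hA, hE⟩))) hCle
  have hX := hM Q q f u p G hsol hq hf hG hcl hA hE hC hD hF θ hθ hθ2
  have halg := localEnergy_algebra hθ hcT.le hc1 hC4 (by linarith : (0 : ℝ) ≤ c2)
    (by linarith : (0 : ℝ) < q) hCle' hX
  refine halg.trans (le_of_eq ?_)
  have e1 : (κ₁ : ℝ≥0∞) = ENNReal.ofReal (2 * cT * (cT * c1 + 3 / 2)) * (C0' : ℝ≥0∞) ^ (2 / 3 : ℝ) := by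
    rw [hκ₁, ENNReal.coe_mul, ENNReal.coe_rpow_of_nonneg _ (by norm_num)]
    rfl
  have e2 : (κ₂ : ℝ≥0∞) = ENNReal.ofReal (cT * (cT * C4) ^ 2) := rfl
  have e3 : (κ₃ : ℝ≥0∞) = ENNReal.ofReal (cT * (2 * cT) ^ 2) := rfl
  have e4 : (κ₄ : ℝ≥0∞) = ENNReal.ofReal (cT * (2 * cT * c2) ^ 2) := rfl
  rw [e1, e2, e3, e4]
  ring

/-- **Discharge of the decomposition target `localEnergyEstimate`** of
`CKNEpsilonRegularityAssembly.lean` (Robinson–Rodrigo–Sadowski 2016, (16.13), with the force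
term of Caffarelli–Kohn–Nirenberg 1982, §3): the second of the four hypotheses of
`Literature.Analysis.FluidPDE.ckn_epsilon_regularity_of_estimates` is now a theorem (unit scale
`localEnergyEstimate_unitScale` and parabolic scaling `localEnergyEstimate_of_unitScale`).
[cite: RobinsonRodrigoSadowski2016, proof of Thm. 16.1 (16.13)] -/
theorem localEnergyEstimate_holds : localEnergyEstimate :=
  localEnergyEstimate_of_unitScale localEnergyEstimate_unitScale

end Final

end Literature.Analysis.FluidPDE

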